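import Literature.NumberTheory.ConnesConsani2024.ProlateWaveSemilocal
import Literature.NumberTheory.Connes2026.LetterSemilocal
import Mathlib.NumberTheory.EulerProduct.DirichletLSeries
import Mathlib.Data.Finset.NoncommProd
import Mathlib.MeasureTheory.Function.LpSpace.InfiniteSum
import HarnessLib

/-!
# Connes–Consani–Moscovici 2024, §4.2 and §4.7 in the printed generality: a finite set of places `S ∋ ∞`

RH-FREE corpus literature (label, l.1): semilocal harmonic analysis of A. Connes, C. Consani,
H. Moscovici, *Zeta zeros and prolate wave operators*, Ann. Funct. Anal. 15 (2024) = arXiv:2310.18423v2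
[bib: `ConnesConsaniMoscovici2024`], §4.2 "Semilocal Hardy–Titchmarsh transform" and §4.7 "The stability
of Sonin spaces" (held text `paper:arxiv-2310.18423`, tex chunks p0012–p0015).  NO positivity statement,
NO inequality with a prime; nothing here bears on the truth of RH.  WHAT THIS IS NOT: a construction of
`L²(X_S)` or of `w_S` (cell gap G-cc-4), the semilocal trace formula, or any claim about Weil positivity.

Cell `rh-crit`, corpus C1 (Connes–Consani), row t13 (CCM 2024 §4), generation g5.  The row's statement
file `ProlateWaveSemilocal.lean` (same directory) typed every OPERATOR statement of §4.2/§4.7 for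
`S = {∞, p}` only and recorded "TODO(general form): finite commuting products over the primes of `S`",
because the pulled-back `θ_S`, `𝔽_S` for a general finite `S` did not exist in the tree at the time.  They do
now — `Literature.NumberTheory.Connes2026.twistProd P` (`θ_S = Π_{p ∈ P} θ_p`), `twistProdUnit P`,
`semilocalFourierOf P` (`𝔽_S = θ_S 𝔽_{e_ℝ} θ_S⁻¹`), `fourierL2` (`LetterSemilocal.lean`) — and this file
closes the TODO: the statements of §4.2 and §4.7 are typed and PROVED for `S = {∞} ∪ P`, `P` an
arbitrary finite set of primes, over those declarations and the single-prime lemmas of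
`ProlateWaveSemilocal.lean` (`semilocalEta`, `primeDilation`, `primeTwist_fourier`, `fourier_primeTwist`,
`inner_primeTwist_left`, `fourier_lpDilation`, …), which are CITED, not restated.  The printed source states
§4 for "`S` a finite set of places, `∞ ∈ S`" (p0012:L5, L72) and proves Prop. 4.1 (i) "for simplicity [in]
the case `S = {p, ∞}`" (p0012:L114); the general case is the Euler product over `P` of the same geometric
series, which is what is formalised here.

## Dictionary (pull-back to `L²(ℝ)`, as in `ProlateWaveSemilocal.lean` / `SemilocalSoninSpace.lean`)

`L²(X_S)^{K_S} ≅ L²(ℝ)_ev` via `w_S` and `w_∞(f)(u) = u^{1/2}f(u)` (eqs. (18), (42)); under it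
* `η_S(f) =` class of `1_{R_S} ⊗ f`, `η_S(f)(1 × u) = Σ_{γ ∈ Γ_+ ∩ ℤ} f(γu)` (eq. (44) and the display
  after it) ↦ `etaProd P = Π_{p ∈ P} η_p` with **`HasSum (n : factoredNumbers P ↦ D_n) (etaProd P)`**
  (`hasSum_natDilation_etaProd`: `Γ_+ ∩ ℤ =` the `P`-factored positive integers, Mathlib's
  `Nat.factoredNumbers`, cf. `mem_factoredNumbers_iff_padicValRat_eq_zero`), `D_n f = f(n ·)`
  (`natDilation n`, the tree's `lpDilation`); at function level `factoredSum P f u = Σ'_{n} f(nu)`;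
* `θ_S` ↦ `Connes2026.twistProd P`; `𝔽_S` ↦ `Connes2026.semilocalFourierOf P`; `𝔽_{e_ℝ}` ↦ `Connes2026.fourierL2`
  (`= 𝓕` on `L²(ℝ)`, `fourierL2_eq_fourier`);
* `𝒰 = 𝔽_μ ∘ w_∞ ↦ mellin · (½ − is)` on functions with absolutely convergent Mellin integral (as in the
  row file; the `L²` statements are the Mellin–Plancherel extensions).

## What is typed (P = proved here, D = definition, C = cited)

§4.2: eq. (44)/(45)/(46) general `S`: `factoredSum` D, `semilocalEOf` D, `factoredSum_empty` P,
`factoredSum_singleton` (`= primeSum p`) P; operator form `etaAt`/`etaProd` D with `etaProd_empty`,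
`etaProd_singleton` (`= semilocalEta p`) P, `etaProd_insert` P, eq. (44) as printed
`hasSum_natDilation_etaProd` P; **Prop. 4.1 (i) eq. (47) general `S`** `mellin_factoredSum` P (Euler product
of the printed geometric series, interchange by `integral_tsum`); **(ii)** `etaProd_mem_cutoffSpace` P;
**(iii) `semilocalFourierOf_mul_etaProd`** (`𝔽_S ∘ η_S = η_S ∘ 𝔽_{e_ℝ}`) P; **(iv)**
`etaProd_fourier_mem_semilocalFourierOf_cutoffSpace` P; eq. (48) general `S`: `semilocalMultiplierOf`,
`semilocalMOf`, `semilocalDensityOf`, `semilocalMeasureOf`, `semilocalVOf` D (`= semilocalMultiplier p` … for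
`P = {p}`) with Prop. 4.3 (i) `norm_prod_eulerFactor_bounds` / `etaProdEquiv` (bounded with bounded inverse) P
and Prop. 4.3 (ii) `semilocalVOf_factoredSum` P; Prop. 4.2 (i)/(ii) general `S`: `semilocalXiOf` (`ξ_S = η_S h₀`) D,
`semilocalFourierOf_semilocalXiOf` (`𝔽_S ξ_S = ξ_S`) P, `semilocalFourierOf_lpDilation` (`𝔽_S ϑ(λ) = ϑ(λ⁻¹)𝔽_S`) P.
§4.4 general `S`: eq. (51) `dualMultiplierOf`, (52) `betaMulOf`, `dualMeasureOf`, Def. 4.3 eq. (53)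
`dualTransformOf` D (singleton/empty agreement lemmas P); Prop. 4.4 (ii) `dualTransformOf_mul_conj_semilocalVOf` P
(`conj_semilocalMultiplierOf`).
§4.7: `twistFunProd` (`θ_S` at function level) D, eq. (58) general `S` on the Mellin side `mellin_twistFunProd` P;
**Prop. 4.7 (i)** `semilocalFourierOf_mul_twistProd` P; (ii) `dualTransformOf_twistFunProd` P;
**(iii) `inner_twistProd_etaProd`** (`⟨θ_S f | η_S g⟩ = ⟨f | g⟩`) P.
Commutation toolkit (all factors are functions of the scaling group): `commute_lpDilation_lpDilation`,
`commute_lpDilation_twistAt`, `commute_lpDilation_etaAt`, `commute_twistAt_etaAt`, … P.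
Unitarity (Connes 1999 §VII Lemma 1 b), "`F` extends to a unitary operator on `L²(X_S)`", pulled back; the
caveat "unitarity not proved here" of `Connes2026.semilocalFourierOf` / `ConnesConsani2021.semilocalFourier` is
discharged): `inner_twistProd_left` / `adjoint_twistProd` (`θ_S^* = η_S⁻¹`) P, **`inner_semilocalFourierOf`,
`norm_semilocalFourierOf`, `semilocalFourierOf_mem_unitary`, `adjoint_semilocalFourierOf` (`𝔽_S^* = 𝔽_S⁻¹`)** P,
`semilocalFourier_mem_unitary` (`S = {∞, p}`) P, and for Connes 1999 §VII (13): `dualCutoffProj_mul_self`,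
`adjoint_dualCutoffProj`, `isStarProjection_dualCutoffProj` (`P̂_Λ` is an orthogonal projection) P.
Eq. (44)–(45) POINTWISE (appended): `hasSum_coeFn_etaProd` — for a.e. `x`, `Σ_{n P-factored} ξ(nx)` converges
(absolutely, `ae_summable_norm_comp_mul`) to `(η_S ξ)(x)`; `etaProd_coeFn_eq_factoredSum` (`w_S(η_S f) = ℰ_S(f)`:
the operator `etaProd` and the function-level `factoredSum` agree a.e.) P.
No named fact (`def … : Prop`) is introduced; no instance, notation or attribute.

## References

* A. Connes, C. Consani, H. Moscovici, *Zeta zeros and prolate wave operators*, Ann. Funct. Anal. 15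
  (2024) 87, doi:10.1007/s43034-024-00388-z, arXiv:2310.18423v2. [ConnesConsaniMoscovici2024]
* A. Connes, *Trace formula in noncommutative geometry and the zeros of the Riemann zeta function*,
  Selecta Math. 5 (1999), §VII (the semilocal `X_S`, `F = ⊗ F_v`). [Connes1999]
-/

noncomputable section

open _root_.MeasureTheory Complex Set Filter FourierTransform
open scoped Real ComplexConjugate ENNReal InnerProductSpace Topology

namespace Literature.NumberTheory.ConnesConsani2024

open Literature.NumberTheory.LFunctions Literature.Analysis.OperatorTheory
open Literature.NumberTheory.ConnesConsani2021 Literature.NumberTheory.Connes2026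

/-! ## The commutation toolkit: dilations, `θ_p`, `η_p` pairwise commute -/

section Commute

/-- Changing the scale parameter of `lpDilation` along an equality of reals. [folklore] -/
private theorem lpDilation_congr' {a b : ℝ} (h : a = b) (ha : a ≠ 0) (hb : b ≠ 0) :
    (lpDilation (V := ℝ) (F := ℂ) (p := (2 : ℝ≥0∞)) a ha ENNReal.ofNat_ne_top :
        Lp ℂ 2 (volume : Measure ℝ) →L[ℂ] Lp ℂ 2 (volume : Measure ℝ)) =
      lpDilation (V := ℝ) (F := ℂ) (p := (2 : ℝ≥0∞)) b hb ENNReal.ofNat_ne_top := by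
  subst h
  rfl

/-- **Dilations commute**: `D_a D_b = D_{ba} = D_{ab} = D_b D_a` ("the scaling operator commutes with `η_S`",
proof of Thm. 4.1 (ii)). [cite: ConnesConsaniMoscovici2024, proof of Thm. 4.1 (ii) §4.3 p. 18 (arXiv chunk p0013:L52)] -/
theorem commute_lpDilation_lpDilation {a b : ℝ} (ha : a ≠ 0) (hb : b ≠ 0) :
    Commute (lpDilation (V := ℝ) (F := ℂ) (p := (2 : ℝ≥0∞)) a ha ENNReal.ofNat_ne_top)
      (lpDilation (V := ℝ) (F := ℂ) (p := (2 : ℝ≥0∞)) b hb ENNReal.ofNat_ne_top) := by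
  change _ * _ = _ * _
  rw [lpDilation_mul, lpDilation_mul]
  exact lpDilation_congr' (mul_comm _ _) _ _

variable (q : ℕ) [hq : Fact q.Prime]

/-- `θ_q = 1 − q⁻¹ D_{q⁻¹}` as an operator identity (the tree's definition of `primeTwist`).
[cite: ConnesConsaniMoscovici2024, §4.6 Lemma after Def. 4.5 (ii) p. 22 (arXiv chunk p0015:L1–L5)] -/
theorem primeTwist_eq_one_sub :
    primeTwist q = 1 - ((q : ℂ)⁻¹) •
      lpDilation (V := ℝ) (F := ℂ) (p := (2 : ℝ≥0∞)) ((q : ℝ)⁻¹)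
        (inv_ne_zero (Nat.cast_ne_zero.mpr hq.out.ne_zero)) ENNReal.ofNat_ne_top :=
  rfl

/-- `D_q = lpDilation q` (the tree's definition of `primeDilation`). [cite: ConnesConsaniMoscovici2024, §4.2 eq. (44) p. 16 (arXiv chunk p0012:L74)] -/
theorem primeDilation_eq_lpDilation :
    primeDilation q = lpDilation (V := ℝ) (F := ℂ) (p := (2 : ℝ≥0∞)) (q : ℝ)
      (Nat.cast_ne_zero.mpr hq.out.ne_zero) ENNReal.ofNat_ne_top :=
  rfl

/-- Every dilation commutes with `θ_q`. [cite: ConnesConsaniMoscovici2024, proof of Thm. 4.1 (ii) §4.3 p. 18 (arXiv chunk p0013:L52)] -/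
theorem commute_lpDilation_primeTwist {a : ℝ} (ha : a ≠ 0) :
    Commute (lpDilation (V := ℝ) (F := ℂ) (p := (2 : ℝ≥0∞)) a ha ENNReal.ofNat_ne_top) (primeTwist q) := by
  rw [primeTwist_eq_one_sub]
  exact (Commute.one_right _).sub_right ((commute_lpDilation_lpDilation ha _).smul_right _)

/-- Every dilation commutes with `D_q`. [cite: ConnesConsaniMoscovici2024, proof of Thm. 4.1 (ii) §4.3 p. 18 (arXiv chunk p0013:L52)] -/
theorem commute_lpDilation_primeDilation {a : ℝ} (ha : a ≠ 0) :
    Commute (lpDilation (V := ℝ) (F := ℂ) (p := (2 : ℝ≥0∞)) a ha ENNReal.ofNat_ne_top) (primeDilation q) := by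
  rw [primeDilation_eq_lpDilation]
  exact commute_lpDilation_lpDilation ha _

/-- `η_q = (1 − D_q)⁻¹` as the inverse of the unit `Units.oneSub D_q` (the tree's definition of `semilocalEta`).
[cite: ConnesConsaniMoscovici2024, §4.2 eqs. (44)–(46) pp. 16–17 (arXiv chunk p0012:L74–L94)] -/
theorem semilocalEta_eq_units_inv :
    semilocalEta q = ((Units.oneSub (primeDilation q) (norm_primeDilation_lt_one q))⁻¹ :
      (Lp ℂ 2 (volume : Measure ℝ) →L[ℂ] Lp ℂ 2 (volume : Measure ℝ))ˣ) :=
  rfl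

/-- An operator commuting with `D_q` commutes with `η_q = (1 − D_q)⁻¹`. [cite: ConnesConsaniMoscovici2024, proof of Thm. 4.1 (ii) §4.3 p. 18 (arXiv chunk p0013:L52)] -/
theorem commute_semilocalEta_of_commute_primeDilation
    {T : Lp ℂ 2 (volume : Measure ℝ) →L[ℂ] Lp ℂ 2 (volume : Measure ℝ)} (h : Commute T (primeDilation q)) :
    Commute T (semilocalEta q) := by
  have h1 : Commute T ((Units.oneSub (primeDilation q) (norm_primeDilation_lt_one q) :
      (Lp ℂ 2 (volume : Measure ℝ) →L[ℂ] Lp ℂ 2 (volume : Measure ℝ))ˣ) :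
      Lp ℂ 2 (volume : Measure ℝ) →L[ℂ] Lp ℂ 2 (volume : Measure ℝ)) := by
    rw [Units.val_oneSub]
    exact (Commute.one_right _).sub_right h
  rw [semilocalEta_eq_units_inv]
  exact h1.units_inv_right

/-- Every dilation commutes with `η_q`. [cite: ConnesConsaniMoscovici2024, proof of Thm. 4.1 (ii) §4.3 p. 18 (arXiv chunk p0013:L52)] -/
theorem commute_lpDilation_semilocalEta {a : ℝ} (ha : a ≠ 0) :
    Commute (lpDilation (V := ℝ) (F := ℂ) (p := (2 : ℝ≥0∞)) a ha ENNReal.ofNat_ne_top) (semilocalEta q) :=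
  commute_semilocalEta_of_commute_primeDilation q (commute_lpDilation_primeDilation q ha)

variable (r : ℕ) [hr : Fact r.Prime]

/-- `θ_q` and `θ_r` commute. [cite: ConnesConsaniMoscovici2024, §4.6 Lemma after Def. 4.5 (ii) p. 22 ("`θ_S = ⊗ θ_p`")] -/
theorem commute_primeTwist_primeTwist : Commute (primeTwist q) (primeTwist r) := by
  rw [primeTwist_eq_one_sub q]
  exact (Commute.one_left _).sub_left ((commute_lpDilation_primeTwist r _).smul_left _)

/-- `θ_q` and `D_r` commute. [cite: ConnesConsaniMoscovici2024, proof of Thm. 4.1 (ii) §4.3 p. 18 (arXiv chunk p0013:L52)] -/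
theorem commute_primeTwist_primeDilation : Commute (primeTwist q) (primeDilation r) :=
  (commute_lpDilation_primeTwist q _).symm

/-- `θ_q` and `η_r` commute. [cite: ConnesConsaniMoscovici2024, proof of Prop. 4.7 (iii) §4.7 p. 23 (arXiv chunk p0015:L70–L81)] -/
theorem commute_primeTwist_semilocalEta : Commute (primeTwist q) (semilocalEta r) :=
  commute_semilocalEta_of_commute_primeDilation r (commute_primeTwist_primeDilation q r)

/-- `η_q` and `η_r` commute. [cite: ConnesConsaniMoscovici2024, §4.2 eq. (44) p. 16 ("`Σ_{Γ_+}`", a commutative sum)] -/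
theorem commute_semilocalEta_semilocalEta : Commute (semilocalEta q) (semilocalEta r) :=
  commute_semilocalEta_of_commute_primeDilation r
    (commute_semilocalEta_of_commute_primeDilation q (commute_lpDilation_primeDilation q _)).symm

/-- `D_q` and `η_r` commute. [cite: ConnesConsaniMoscovici2024, proof of Thm. 4.1 (ii) §4.3 p. 18 (arXiv chunk p0013:L52)] -/
theorem commute_primeDilation_semilocalEta : Commute (primeDilation q) (semilocalEta r) :=
  commute_lpDilation_semilocalEta r _

end Commute

/-! ## `η_S = Π_{p ∈ P} η_p` for `S = {∞} ∪ P` (eq. (44)), mirror of `Connes2026.twistProd` -/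

section EtaProd

/-- `η` at one natural number: `η_p = Σ_k D_{p^k} = (1 − D_p)⁻¹` (`ConnesConsani2024.semilocalEta`) if `p` is
prime, the identity otherwise (junk; mirror of `Connes2026.twistAt`). [cite: ConnesConsaniMoscovici2024, §4.2 eq. (44) p. 16 (arXiv chunk p0012:L74)] -/
def etaAt (n : ℕ) : Lp ℂ 2 (volume : Measure ℝ) →L[ℂ] Lp ℂ 2 (volume : Measure ℝ) :=
  if h : n.Prime then @semilocalEta n ⟨h⟩ else 1

/-- `η⁻¹` at one natural number: `η_p⁻¹ = 1 − D_p` if `p` is prime, the identity otherwise.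
[cite: ConnesConsaniMoscovici2024, proof of Prop. 4.7 (iii) §4.7 p. 23 (arXiv chunk p0015:L70–L81)] -/
def etaInvAt (n : ℕ) : Lp ℂ 2 (volume : Measure ℝ) →L[ℂ] Lp ℂ 2 (volume : Measure ℝ) :=
  if h : n.Prime then 1 - @primeDilation n ⟨h⟩ else 1

/-- For a prime, `etaAt p = η_p`. [cite: ConnesConsaniMoscovici2024, §4.2 eq. (44) p. 16 (arXiv chunk p0012:L74)] -/
theorem etaAt_of_prime (q : ℕ) [hq : Fact q.Prime] : etaAt q = semilocalEta q := by
  rw [etaAt, dif_pos hq.out]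

/-- For a prime, `etaInvAt p = 1 − D_p`. [cite: ConnesConsaniMoscovici2024, §4.2 p. 17 (arXiv chunk p0013:L7)] -/
theorem etaInvAt_of_prime (q : ℕ) [hq : Fact q.Prime] : etaInvAt q = 1 - primeDilation q := by
  rw [etaInvAt, dif_pos hq.out]

/-- For a non-prime, `etaAt n = 1` (`η_S` is the product over the PRIMES of `S`). [cite: ConnesConsaniMoscovici2024, §4.2 eq. (44) p. 16 (arXiv chunk p0012:L72–L74)] -/
theorem etaAt_of_not_prime {n : ℕ} (hn : ¬ n.Prime) : etaAt n = 1 := by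
  rw [etaAt, dif_neg hn]

/-- For a non-prime, `etaInvAt n = 1` (`η_S⁻¹` is the product over the PRIMES of `S`). [cite: ConnesConsaniMoscovici2024, §4.2 p. 17 (arXiv chunk p0013:L7)] -/
theorem etaInvAt_of_not_prime {n : ℕ} (hn : ¬ n.Prime) : etaInvAt n = 1 := by
  rw [etaInvAt, dif_neg hn]

/-- For a non-prime, `twistAt n = 1` (`θ_S` is the product over the PRIMES of `S`). [cite: ConnesConsaniMoscovici2024, §4.6 Lemma after Def. 4.5 (ii) p. 22 (arXiv chunk p0014:L89–L93)] -/
theorem twistAt_of_not_prime {n : ℕ} (hn : ¬ n.Prime) : twistAt n = 1 := by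
  rw [twistAt, dif_neg hn]

/-- `η_p⁻¹ η_p = 1` factorwise. [cite: ConnesConsaniMoscovici2024, §4.2 p. 17 (arXiv chunk p0013:L7)] -/
theorem etaInvAt_mul_etaAt (n : ℕ) : etaInvAt n * etaAt n = 1 := by
  by_cases hn : n.Prime
  · haveI : Fact n.Prime := ⟨hn⟩
    rw [etaAt_of_prime, etaInvAt_of_prime, one_sub_primeDilation_mul_semilocalEta]
  · rw [etaAt_of_not_prime hn, etaInvAt_of_not_prime hn, mul_one]

/-- `η_p η_p⁻¹ = 1` factorwise. [cite: ConnesConsaniMoscovici2024, §4.2 p. 17 (arXiv chunk p0013:L7)] -/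
theorem etaAt_mul_etaInvAt (n : ℕ) : etaAt n * etaInvAt n = 1 := by
  by_cases hn : n.Prime
  · haveI : Fact n.Prime := ⟨hn⟩
    rw [etaAt_of_prime, etaInvAt_of_prime, semilocalEta_mul_one_sub_primeDilation]
  · rw [etaAt_of_not_prime hn, etaInvAt_of_not_prime hn, mul_one]

/-- Dilations commute with `twistAt n`. [cite: ConnesConsaniMoscovici2024, proof of Thm. 4.1 (ii) §4.3 p. 18 (arXiv chunk p0013:L52)] -/
theorem commute_lpDilation_twistAt {a : ℝ} (ha : a ≠ 0) (n : ℕ) :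
    Commute (lpDilation (V := ℝ) (F := ℂ) (p := (2 : ℝ≥0∞)) a ha ENNReal.ofNat_ne_top) (twistAt n) := by
  by_cases hn : n.Prime
  · haveI : Fact n.Prime := ⟨hn⟩
    rw [twistAt_of_prime]
    exact commute_lpDilation_primeTwist n ha
  · rw [twistAt_of_not_prime hn]
    exact Commute.one_right _

/-- Dilations commute with `etaAt n`. [cite: ConnesConsaniMoscovici2024, proof of Thm. 4.1 (ii) §4.3 p. 18 (arXiv chunk p0013:L52)] -/
theorem commute_lpDilation_etaAt {a : ℝ} (ha : a ≠ 0) (n : ℕ) :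
    Commute (lpDilation (V := ℝ) (F := ℂ) (p := (2 : ℝ≥0∞)) a ha ENNReal.ofNat_ne_top) (etaAt n) := by
  by_cases hn : n.Prime
  · haveI : Fact n.Prime := ⟨hn⟩
    rw [etaAt_of_prime]
    exact commute_lpDilation_semilocalEta n ha
  · rw [etaAt_of_not_prime hn]
    exact Commute.one_right _

/-- Dilations commute with `etaInvAt n`. [cite: ConnesConsaniMoscovici2024, proof of Thm. 4.1 (ii) §4.3 p. 18 (arXiv chunk p0013:L52)] -/
theorem commute_lpDilation_etaInvAt {a : ℝ} (ha : a ≠ 0) (n : ℕ) :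
    Commute (lpDilation (V := ℝ) (F := ℂ) (p := (2 : ℝ≥0∞)) a ha ENNReal.ofNat_ne_top) (etaInvAt n) := by
  by_cases hn : n.Prime
  · haveI : Fact n.Prime := ⟨hn⟩
    rw [etaInvAt_of_prime]
    exact (Commute.one_right _).sub_right (commute_lpDilation_primeDilation n ha)
  · rw [etaInvAt_of_not_prime hn]
    exact Commute.one_right _

/-- `twistAt m` and `twistAt n` commute. [cite: ConnesConsaniMoscovici2024, §4.6 Lemma after Def. 4.5 (ii) p. 22] -/
theorem commute_twistAt_twistAt (m n : ℕ) : Commute (twistAt m) (twistAt n) := by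
  by_cases hm : m.Prime
  · haveI : Fact m.Prime := ⟨hm⟩
    rw [twistAt_of_prime m, primeTwist_eq_one_sub]
    exact (Commute.one_left _).sub_left ((commute_lpDilation_twistAt _ n).smul_left _)
  · rw [twistAt_of_not_prime hm]
    exact Commute.one_left _

/-- `twistAt m` and `etaAt n` commute. [cite: ConnesConsaniMoscovici2024, proof of Prop. 4.7 (iii) §4.7 p. 23] -/
theorem commute_twistAt_etaAt (m n : ℕ) : Commute (twistAt m) (etaAt n) := by
  by_cases hm : m.Prime
  · haveI : Fact m.Prime := ⟨hm⟩
    rw [twistAt_of_prime m, primeTwist_eq_one_sub]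
    exact (Commute.one_left _).sub_left ((commute_lpDilation_etaAt _ n).smul_left _)
  · rw [twistAt_of_not_prime hm]
    exact Commute.one_left _

/-- `twistAt m` and `etaInvAt n` commute. [cite: ConnesConsaniMoscovici2024, proof of Prop. 4.7 (iii) §4.7 p. 23] -/
theorem commute_twistAt_etaInvAt (m n : ℕ) : Commute (twistAt m) (etaInvAt n) := by
  by_cases hm : m.Prime
  · haveI : Fact m.Prime := ⟨hm⟩
    rw [twistAt_of_prime m, primeTwist_eq_one_sub]
    exact (Commute.one_left _).sub_left ((commute_lpDilation_etaInvAt _ n).smul_left _)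
  · rw [twistAt_of_not_prime hm]
    exact Commute.one_left _

/-- `etaInvAt m` and `etaAt n` commute. [cite: ConnesConsaniMoscovici2024, §4.2 eq. (44) p. 16] -/
theorem commute_etaInvAt_etaAt (m n : ℕ) : Commute (etaInvAt m) (etaAt n) := by
  by_cases hm : m.Prime
  · haveI : Fact m.Prime := ⟨hm⟩
    rw [etaInvAt_of_prime m, primeDilation_eq_lpDilation]
    exact (Commute.one_left _).sub_left (commute_lpDilation_etaAt _ n)
  · rw [etaInvAt_of_not_prime hm]
    exact Commute.one_left _

/-- `etaInvAt m` and `etaInvAt n` commute. [cite: ConnesConsaniMoscovici2024, §4.2 eq. (44) p. 16] -/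
theorem commute_etaInvAt_etaInvAt (m n : ℕ) : Commute (etaInvAt m) (etaInvAt n) := by
  by_cases hm : m.Prime
  · haveI : Fact m.Prime := ⟨hm⟩
    rw [etaInvAt_of_prime m, primeDilation_eq_lpDilation]
    exact (Commute.one_left _).sub_left (commute_lpDilation_etaInvAt _ n)
  · rw [etaInvAt_of_not_prime hm]
    exact Commute.one_left _

/-- `etaAt m` and `etaAt n` commute. [cite: ConnesConsaniMoscovici2024, §4.2 eq. (44) p. 16] -/
theorem commute_etaAt_etaAt (m n : ℕ) : Commute (etaAt m) (etaAt n) := by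
  by_cases hn : n.Prime
  · haveI : Fact n.Prime := ⟨hn⟩
    rw [etaAt_of_prime n]
    refine commute_semilocalEta_of_commute_primeDilation n ?_
    rw [primeDilation_eq_lpDilation]
    exact (commute_lpDilation_etaAt _ m).symm
  · rw [etaAt_of_not_prime hn]
    exact Commute.one_right _

/-- **`η_S := Π_{p ∈ P} η_p`** for `S = {∞} ∪ P` — the pull-back to `L²(ℝ)_ev` of "the class of the function
`1_{R_S} ⊗ f` in `L²(X_S)`" (eq. (44)), as the product of the commuting single-prime `η_p = Σ_k D_{p^k}` along
the increasing enumeration of `P` (mirror of `Connes2026.twistProd`); its expansion as the printed sum over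
`Γ_+ ∩ ℤ` is `hasSum_natDilation_etaProd`. [cite: ConnesConsaniMoscovici2024, §4.2 eq. (44) p. 16 (arXiv chunk p0012:L72–L81)] -/
def etaProd (P : Finset ℕ) : Lp ℂ 2 (volume : Measure ℝ) →L[ℂ] Lp ℂ 2 (volume : Measure ℝ) :=
  ((P.sort (· ≤ ·)).map etaAt).prod

/-- **`η_S⁻¹ = Π_{p ∈ P} (1 − D_p)`**, the inverse of `η_S` (Prop. 4.3 (i): "bounded with bounded inverse").
[cite: ConnesConsaniMoscovici2024, Prop. 4.3 (i) §4.2 p. 18 (arXiv chunk p0013:L21)] -/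
def etaInvProd (P : Finset ℕ) : Lp ℂ 2 (volume : Measure ℝ) →L[ℂ] Lp ℂ 2 (volume : Measure ℝ) :=
  ((P.sort (· ≤ ·)).map etaInvAt).prod

/-- `η_∅ = 1` (`S = {∞}`). [cite: ConnesConsaniMoscovici2024, §4.2 eq. (44) p. 16] -/
theorem etaProd_empty : etaProd ∅ = 1 := by simp [etaProd]

/-- `η_{{p}} = η_p`: agreement with `ProlateWaveSemilocal.lean` (`S = {∞, p}`). [cite: ConnesConsaniMoscovici2024, §4.2 eq. (44) p. 16] -/
theorem etaProd_singleton (q : ℕ) [Fact q.Prime] : etaProd {q} = semilocalEta q := by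
  simp [etaProd, etaAt_of_prime]

/-- `η_S` as a `Finset.noncommProd` (the factors pairwise commute, so the enumeration is immaterial). [cite: ConnesConsaniMoscovici2024, §4.2 eq. (44) p. 16] -/
theorem etaProd_eq_noncommProd (P : Finset ℕ) :
    etaProd P = P.noncommProd etaAt (fun a _ b _ _ => commute_etaAt_etaAt a b) := by
  have h := Finset.noncommProd_toFinset (α := ℕ) (P.sort (· ≤ ·)) etaAt
    (fun a _ b _ _ => commute_etaAt_etaAt a b) (Finset.sort_nodup _ _)
  rw [etaProd, ← h]
  exact Finset.noncommProd_congr (Finset.sort_toFinset _ _) (fun _ _ => rfl) _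

/-- `η_S⁻¹` as a `Finset.noncommProd`. [cite: ConnesConsaniMoscovici2024, Prop. 4.3 (i) §4.2 p. 18] -/
theorem etaInvProd_eq_noncommProd (P : Finset ℕ) :
    etaInvProd P = P.noncommProd etaInvAt (fun a _ b _ _ => commute_etaInvAt_etaInvAt a b) := by
  have h := Finset.noncommProd_toFinset (α := ℕ) (P.sort (· ≤ ·)) etaInvAt
    (fun a _ b _ _ => commute_etaInvAt_etaInvAt a b) (Finset.sort_nodup _ _)
  rw [etaInvProd, ← h]
  exact Finset.noncommProd_congr (Finset.sort_toFinset _ _) (fun _ _ => rfl) _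

/-- `θ_S` as a `Finset.noncommProd`. [cite: ConnesConsaniMoscovici2024, §4.6 Lemma after Def. 4.5 (ii) p. 22] -/
theorem twistProd_eq_noncommProd (P : Finset ℕ) :
    twistProd P = P.noncommProd twistAt (fun a _ b _ _ => commute_twistAt_twistAt a b) := by
  have h := Finset.noncommProd_toFinset (α := ℕ) (P.sort (· ≤ ·)) twistAt
    (fun a _ b _ _ => commute_twistAt_twistAt a b) (Finset.sort_nodup _ _)
  rw [twistProd, ← h]
  exact Finset.noncommProd_congr (Finset.sort_toFinset _ _) (fun _ _ => rfl) _

/-- `η_{S ∪ {a}} = η_a η_S` for `a ∉ P`. [cite: ConnesConsaniMoscovici2024, §4.2 eq. (44) p. 16] -/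
theorem etaProd_insert {a : ℕ} {P : Finset ℕ} (ha : a ∉ P) :
    etaProd (insert a P) = etaAt a * etaProd P := by
  rw [etaProd_eq_noncommProd, etaProd_eq_noncommProd,
    Finset.noncommProd_insert_of_notMem _ _ _ _ ha]

/-- `η⁻¹_{S ∪ {a}} = η_a⁻¹ η_S⁻¹` for `a ∉ P`. [cite: ConnesConsaniMoscovici2024, Prop. 4.3 (i) §4.2 p. 18] -/
theorem etaInvProd_insert {a : ℕ} {P : Finset ℕ} (ha : a ∉ P) :
    etaInvProd (insert a P) = etaInvAt a * etaInvProd P := by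
  rw [etaInvProd_eq_noncommProd, etaInvProd_eq_noncommProd,
    Finset.noncommProd_insert_of_notMem _ _ _ _ ha]

/-- `θ_{S ∪ {a}} = θ_a θ_S` for `a ∉ P`. [cite: ConnesConsaniMoscovici2024, §4.6 Lemma after Def. 4.5 (ii) p. 22] -/
theorem twistProd_insert {a : ℕ} {P : Finset ℕ} (ha : a ∉ P) :
    twistProd (insert a P) = twistAt a * twistProd P := by
  rw [twistProd_eq_noncommProd, twistProd_eq_noncommProd,
    Finset.noncommProd_insert_of_notMem _ _ _ _ ha]

/-- `η_S⁻¹ η_S = 1`. [cite: ConnesConsaniMoscovici2024, Prop. 4.3 (i) §4.2 p. 18 (arXiv chunk p0013:L21)] -/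
theorem etaInvProd_mul_etaProd (P : Finset ℕ) : etaInvProd P * etaProd P = 1 := by
  induction P using Finset.induction_on with
  | empty => simp [etaProd, etaInvProd]
  | insert a P ha ih =>
    rw [etaProd_insert ha, etaInvProd_insert ha]
    have hc : Commute (etaInvProd P) (etaAt a) := Commute.list_prod_left _ _ fun x hx => by
      obtain ⟨n, -, rfl⟩ := List.mem_map.mp hx
      exact commute_etaInvAt_etaAt n a
    calc etaInvAt a * etaInvProd P * (etaAt a * etaProd P)
        = etaInvAt a * (etaInvProd P * etaAt a) * etaProd P := by simp only [mul_assoc]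
      _ = etaInvAt a * (etaAt a * etaInvProd P) * etaProd P := by rw [hc.eq]
      _ = (etaInvAt a * etaAt a) * (etaInvProd P * etaProd P) := by simp only [mul_assoc]
      _ = 1 := by rw [ih, etaInvAt_mul_etaAt, mul_one]

/-- `η_S η_S⁻¹ = 1`. [cite: ConnesConsaniMoscovici2024, Prop. 4.3 (i) §4.2 p. 18 (arXiv chunk p0013:L21)] -/
theorem etaProd_mul_etaInvProd (P : Finset ℕ) : etaProd P * etaInvProd P = 1 := by
  induction P using Finset.induction_on with
  | empty => simp [etaProd, etaInvProd]
  | insert a P ha ih =>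
    rw [etaProd_insert ha, etaInvProd_insert ha]
    have hc : Commute (etaProd P) (etaInvAt a) := Commute.list_prod_left _ _ fun x hx => by
      obtain ⟨n, -, rfl⟩ := List.mem_map.mp hx
      exact (commute_etaInvAt_etaAt a n).symm
    calc etaAt a * etaProd P * (etaInvAt a * etaInvProd P)
        = etaAt a * (etaProd P * etaInvAt a) * etaInvProd P := by simp only [mul_assoc]
      _ = etaAt a * (etaInvAt a * etaProd P) * etaInvProd P := by rw [hc.eq]
      _ = (etaAt a * etaInvAt a) * (etaProd P * etaInvProd P) := by simp only [mul_assoc]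
      _ = 1 := by rw [ih, etaAt_mul_etaInvAt, mul_one]

/-- **`η_S` is a bicontinuous isomorphism of `L²(ℝ)` with inverse `Π_p (1 − D_p)`** — the operator content of
Prop. 4.3 (i) ("`ι_S` is bounded with bounded inverse", read through the diagram (49) `𝒱_S ∘ η_S = ι_S ∘ 𝒱`).
[cite: ConnesConsaniMoscovici2024, Prop. 4.3 (i) and diagram (49) §4.2 p. 18 (arXiv chunk p0013:L21–L33)] -/
def etaProdEquiv (P : Finset ℕ) : Lp ℂ 2 (volume : Measure ℝ) ≃L[ℂ] Lp ℂ 2 (volume : Measure ℝ) :=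
  ContinuousLinearEquiv.ofUnit
    { val := etaProd P
      inv := etaInvProd P
      val_inv := etaProd_mul_etaInvProd P
      inv_val := etaInvProd_mul_etaProd P }

/-- `etaProdEquiv` acts as `η_S`. [cite: ConnesConsaniMoscovici2024, Prop. 4.3 (i) §4.2 p. 18] -/
theorem etaProdEquiv_apply (P : Finset ℕ) (ξ : Lp ℂ 2 (volume : Measure ℝ)) :
    etaProdEquiv P ξ = etaProd P ξ := rfl

/-- `etaProdEquiv⁻¹` acts as `Π_p (1 − D_p)`. [cite: ConnesConsaniMoscovici2024, Prop. 4.3 (i) §4.2 p. 18] -/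
theorem etaProdEquiv_symm_apply (P : Finset ℕ) (ξ : Lp ℂ 2 (volume : Measure ℝ)) :
    (etaProdEquiv P).symm ξ = etaInvProd P ξ := rfl

/-- Dilations commute with `η_S`. [cite: ConnesConsaniMoscovici2024, proof of Thm. 4.1 (ii) §4.3 p. 18 (arXiv chunk p0013:L52)] -/
theorem commute_lpDilation_etaProd {a : ℝ} (ha : a ≠ 0) (P : Finset ℕ) :
    Commute (lpDilation (V := ℝ) (F := ℂ) (p := (2 : ℝ≥0∞)) a ha ENNReal.ofNat_ne_top) (etaProd P) :=
  Commute.list_prod_right _ _ fun x hx => by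
    obtain ⟨n, -, rfl⟩ := List.mem_map.mp hx
    exact commute_lpDilation_etaAt ha n

/-- Dilations commute with `θ_S`. [cite: ConnesConsaniMoscovici2024, proof of Thm. 4.6 §4.7 p. 23 (arXiv chunk p0015:L88)] -/
theorem commute_lpDilation_twistProd {a : ℝ} (ha : a ≠ 0) (P : Finset ℕ) :
    Commute (lpDilation (V := ℝ) (F := ℂ) (p := (2 : ℝ≥0∞)) a ha ENNReal.ofNat_ne_top) (twistProd P) :=
  Commute.list_prod_right _ _ fun x hx => by
    obtain ⟨n, -, rfl⟩ := List.mem_map.mp hx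
    exact commute_lpDilation_twistAt ha n

/-- Dilations commute with `θ_S⁻¹`. [cite: ConnesConsaniMoscovici2024, proof of Thm. 4.6 §4.7 p. 23 (arXiv chunk p0015:L88)] -/
theorem commute_lpDilation_twistProdUnit_inv {a : ℝ} (ha : a ≠ 0) (P : Finset ℕ) :
    Commute (lpDilation (V := ℝ) (F := ℂ) (p := (2 : ℝ≥0∞)) a ha ENNReal.ofNat_ne_top)
      (↑(twistProdUnit P)⁻¹ : Lp ℂ 2 (volume : Measure ℝ) →L[ℂ] Lp ℂ 2 (volume : Measure ℝ)) := by
  have h : Commute (lpDilation (V := ℝ) (F := ℂ) (p := (2 : ℝ≥0∞)) a ha ENNReal.ofNat_ne_top)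
      (↑(twistProdUnit P) : Lp ℂ 2 (volume : Measure ℝ) →L[ℂ] Lp ℂ 2 (volume : Measure ℝ)) := by
    rw [val_twistProdUnit]
    exact commute_lpDilation_twistProd ha P
  exact h.units_inv_right

/-- `θ_S` and `η_{S'}` commute. [cite: ConnesConsaniMoscovici2024, proof of Prop. 4.7 (iii) §4.7 p. 23] -/
theorem commute_twistProd_etaProd (P P' : Finset ℕ) : Commute (twistProd P) (etaProd P') :=
  Commute.list_prod_left _ _ fun x hx => by
    obtain ⟨m, -, rfl⟩ := List.mem_map.mp hx
    exact Commute.list_prod_right _ _ fun y hy => by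
      obtain ⟨n, -, rfl⟩ := List.mem_map.mp hy
      exact commute_twistAt_etaAt m n

end EtaProd

/-! ## Proposition 4.1 (iii) and Proposition 4.7 (i), (iii) for a general finite `S` -/

section Intertwining

/-- `Connes2026.fourierL2` is Mathlib's `𝓕` on `L²(ℝ)`. [cite: ConnesConsani2021, eq. (13) p. 7] -/
theorem fourierL2_eq_fourier (ξ : Lp ℂ 2 (volume : Measure ℝ)) :
    fourierL2 ξ = (𝓕 ξ : Lp ℂ 2 (volume : Measure ℝ)) := rfl

/-- **The single-prime key identity**: `𝓕` commutes with `(1 − D_p) θ_p` (from `θ_p 𝓕 = 𝓕 (1 − D_p)` and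
`𝓕 θ_p = (1 − D_p) 𝓕`, the two dilation laws behind "`1_{ℤ_p}` is its own Fourier transform").
[cite: ConnesConsaniMoscovici2024, proof of Prop. 4.1 (iii) §4.2 p. 17 (arXiv chunk p0012:L128)] -/
theorem commute_fourierL2_etaInvAt_mul_twistAt (n : ℕ) : Commute fourierL2 (etaInvAt n * twistAt n) := by
  by_cases hn : n.Prime
  · haveI : Fact n.Prime := ⟨hn⟩
    rw [etaInvAt_of_prime, twistAt_of_prime]
    change fourierL2 * ((1 - primeDilation n) * primeTwist n) = ((1 - primeDilation n) * primeTwist n) * fourierL2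
    rw [(((Commute.one_left _).sub_left (commute_primeTwist_primeDilation n n).symm) :
      Commute (1 - primeDilation n) (primeTwist n)).eq]
    ext ξ : 1
    change fourierL2 (primeTwist n (ξ - primeDilation n ξ)) =
      primeTwist n ((fourierL2 ξ) - primeDilation n (fourierL2 ξ))
    simp only [fourierL2_eq_fourier]
    rw [fourier_primeTwist, ← primeTwist_fourier, primeDilation_primeTwist_comm, ← map_sub (primeTwist n)]
  · rw [etaInvAt_of_not_prime hn, twistAt_of_not_prime hn, mul_one]
    exact Commute.one_right _

/-- `𝓕` commutes with `η_S⁻¹ θ_S = Π_p (1 − D_p) θ_p`. [cite: ConnesConsaniMoscovici2024, proof of Prop. 4.1 (iii) §4.2 p. 17 (arXiv chunk p0012:L128)] -/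
theorem commute_fourierL2_etaInvProd_mul_twistProd (P : Finset ℕ) :
    Commute fourierL2 (etaInvProd P * twistProd P) := by
  have hdis := Finset.noncommProd_mul_distrib (s := P) etaInvAt twistAt
    (fun a _ b _ _ => commute_etaInvAt_etaInvAt a b) (fun a _ b _ _ => commute_twistAt_twistAt a b)
    (fun a _ b _ _ => commute_twistAt_etaInvAt a b)
  rw [etaInvProd_eq_noncommProd, twistProd_eq_noncommProd, ← hdis]
  exact Finset.noncommProd_commute _ _ _ _ fun n _ => commute_fourierL2_etaInvAt_mul_twistAt n

/-- **Proposition 4.1 (iii) for a general finite `S ∋ ∞`**, pulled back to `L²(ℝ)`, PROVED: "Let the Fourier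
transform for `ℚ_p` be normalized so that the function `1_{ℤ_p}` is its own Fourier transform and let `𝔽_S`,
acting in `L²(X_S)`, be induced by the tensor product of the local Fourier transforms. One has
`𝔽_S ∘ η_S = η_S ∘ 𝔽_{e_ℝ}`."  With the tree's pulled-back `𝔽_S = semilocalFourierOf P = θ_S 𝔽 θ_S⁻¹` and
`η_S = etaProd P`: `semilocalFourierOf P * etaProd P = etaProd P * fourierL2`.  Proof: `𝓕` commutes with
`B = η_S⁻¹θ_S` (factorwise, previous lemmas), and `η_S 𝓕 = η_S 𝓕 B (θ_S⁻¹η_S) = η_S B 𝓕 θ_S⁻¹ η_S = θ_S 𝓕 θ_S⁻¹ η_S`.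
(Printed proof: "This follows since `1_{R_S}` is its own Fourier transform.")  RH-FREE.
[cite: ConnesConsaniMoscovici2024, Prop. 4.1 (iii) §4.2 p. 17 (arXiv chunk p0012:L107–L108, proof L128)] -/
theorem semilocalFourierOf_mul_etaProd (P : Finset ℕ) :
    semilocalFourierOf P * etaProd P = etaProd P * fourierL2 := by
  have hkey := (commute_fourierL2_etaInvProd_mul_twistProd P).eq
  have h1 : (etaInvProd P * twistProd P) *
      ((↑(twistProdUnit P)⁻¹ : Lp ℂ 2 (volume : Measure ℝ) →L[ℂ] Lp ℂ 2 (volume : Measure ℝ)) * etaProd P) =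
        etaInvProd P * etaProd P := by
    rw [mul_assoc, ← mul_assoc (twistProd P), twistProd_mul_inv, one_mul]
  symm
  calc etaProd P * fourierL2
      = etaProd P * fourierL2 * ((etaInvProd P * twistProd P) *
          ((↑(twistProdUnit P)⁻¹ : Lp ℂ 2 (volume : Measure ℝ) →L[ℂ] Lp ℂ 2 (volume : Measure ℝ)) *
            etaProd P)) := by rw [h1, etaInvProd_mul_etaProd, mul_one]
    _ = etaProd P * (fourierL2 * (etaInvProd P * twistProd P)) *
          ((↑(twistProdUnit P)⁻¹ : Lp ℂ 2 (volume : Measure ℝ) →L[ℂ] Lp ℂ 2 (volume : Measure ℝ)) *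
            etaProd P) := by simp only [mul_assoc]
    _ = (etaProd P * etaInvProd P) * twistProd P * fourierL2 *
          ((↑(twistProdUnit P)⁻¹ : Lp ℂ 2 (volume : Measure ℝ) →L[ℂ] Lp ℂ 2 (volume : Measure ℝ)) *
            etaProd P) := by rw [hkey]; simp only [mul_assoc]
    _ = semilocalFourierOf P * etaProd P := by
        rw [etaProd_mul_etaInvProd, one_mul, semilocalFourierOf]; simp only [mul_assoc]

/-- Proposition 4.1 (iii), general `S`, applied to a vector: `𝔽_S (η_S ξ) = η_S (𝓕 ξ)`.
[cite: ConnesConsaniMoscovici2024, Prop. 4.1 (iii) §4.2 p. 17 (arXiv chunk p0012:L107–L108)] -/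
theorem semilocalFourierOf_etaProd (P : Finset ℕ) (ξ : Lp ℂ 2 (volume : Measure ℝ)) :
    semilocalFourierOf P (etaProd P ξ) = etaProd P (𝓕 ξ : Lp ℂ 2 (volume : Measure ℝ)) :=
  congrArg (fun T : Lp ℂ 2 (volume : Measure ℝ) →L[ℂ] Lp ℂ 2 (volume : Measure ℝ) => T ξ)
    (semilocalFourierOf_mul_etaProd P)

/-- **Proposition 4.7 (i) for a general finite `S ∋ ∞`**, pulled back: "Let `𝔽_S` be the Fourier transform in
`L²(X_S)`. One has `𝔽_S ∘ θ_S = θ_S ∘ 𝔽_{e_ℝ}`" (proof: "This follows from the equality `𝔽_{e_p}σ_p = σ_p`") —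
`semilocalFourierOf P * twistProd P = twistProd P * fourierL2` (immediate from `𝔽_S = θ_S 𝔽 θ_S⁻¹`, which took
this intertwining as the definition of the pulled-back `𝔽_S`).  RH-FREE.
[cite: ConnesConsaniMoscovici2024, Prop. 4.7 (i) §4.7 p. 22 (arXiv chunk p0015:L42, proof L60)] -/
theorem semilocalFourierOf_mul_twistProd (P : Finset ℕ) :
    semilocalFourierOf P * twistProd P = twistProd P * fourierL2 := by
  rw [semilocalFourierOf, mul_assoc, twistProdUnit_inv_mul, mul_one]

/-- Proposition 4.7 (i), general `S`, applied to a vector: `𝔽_S (θ_S ξ) = θ_S (𝓕 ξ)`.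
[cite: ConnesConsaniMoscovici2024, Prop. 4.7 (i) §4.7 p. 22 (arXiv chunk p0015:L42)] -/
theorem semilocalFourierOf_twistProd (P : Finset ℕ) (ξ : Lp ℂ 2 (volume : Measure ℝ)) :
    semilocalFourierOf P (twistProd P ξ) = twistProd P (𝓕 ξ : Lp ℂ 2 (volume : Measure ℝ)) :=
  congrArg (fun T : Lp ℂ 2 (volume : Measure ℝ) →L[ℂ] Lp ℂ 2 (volume : Measure ℝ) => T ξ)
    (semilocalFourierOf_mul_twistProd P)

/-- **Proposition 4.7 (iii) for a general finite `S ∋ ∞`**, pulled back: "Let `f, g ∈ L²(ℝ)^{ev}`. One has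
`⟨θ_S(f) | η_S(g)⟩ = ⟨f | g⟩`" — `⟪θ_S f, η_S g⟫ = ⟪f, g⟫` in `L²(ℝ)`.  Printed proof: unitarity of `𝒰_S` with
(58) and (47); here by induction on `P` from `θ_p^* = 1 − D_p = η_p⁻¹` (`inner_primeTwist_left`).  PROVED.
RH-FREE. [cite: ConnesConsaniMoscovici2024, Prop. 4.7 (iii) §4.7 p. 22 (arXiv chunk p0015:L58, proof L70–L81)] -/
theorem inner_twistProd_etaProd (P : Finset ℕ) (f g : Lp ℂ 2 (volume : Measure ℝ)) :
    ⟪twistProd P f, etaProd P g⟫_ℂ = ⟪f, g⟫_ℂ := by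
  induction P using Finset.induction_on generalizing f g with
  | empty => simp [twistProd_empty, etaProd_empty]
  | insert a P ha ih =>
    rw [twistProd_insert ha, etaProd_insert ha]
    by_cases hap : a.Prime
    · haveI : Fact a.Prime := ⟨hap⟩
      rw [twistAt_of_prime, etaAt_of_prime]
      change ⟪primeTwist a (twistProd P f), semilocalEta a (etaProd P g)⟫_ℂ = ⟪f, g⟫_ℂ
      rw [inner_primeTwist_left, semilocalEta_sub_primeDilation]
      exact ih f g
    · rw [twistAt_of_not_prime hap, etaAt_of_not_prime hap, one_mul, one_mul]
      exact ih f g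

end Intertwining

/-! ## Eq. (44) as printed: `η_S = Σ_{γ ∈ Γ_+ ∩ ℤ} D_γ` over the `P`-factored positive integers -/

section FactoredNumbers

/-- **The dilation `D_n`, `(D_n f)(x) = f(nx)`**, for a positive integer `n` (the terms of eq. (44):
`η_S(f)(x) = Σ_{γ ∈ Γ_+} f(γx̃)`, `Γ_+ ∩ ℤ` the `P`-factored positive integers); the tree's `lpDilation` at
scale `n` (junk `0` at `n = 0`). [cite: ConnesConsaniMoscovici2024, §4.2 eq. (44) p. 16 (arXiv chunk p0012:L74–L81)] -/
def natDilation (n : ℕ) : Lp ℂ 2 (volume : Measure ℝ) →L[ℂ] Lp ℂ 2 (volume : Measure ℝ) :=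
  if h : n = 0 then 0
  else lpDilation (V := ℝ) (F := ℂ) (p := (2 : ℝ≥0∞)) (n : ℝ) (Nat.cast_ne_zero.mpr h) ENNReal.ofNat_ne_top

/-- `D_n = lpDilation n` for `n ≠ 0`. [cite: ConnesConsaniMoscovici2024, §4.2 eq. (44) p. 16 (arXiv chunk p0012:L74)] -/
theorem natDilation_of_ne_zero {n : ℕ} (hn : n ≠ 0) :
    natDilation n =
      lpDilation (V := ℝ) (F := ℂ) (p := (2 : ℝ≥0∞)) (n : ℝ) (Nat.cast_ne_zero.mpr hn) ENNReal.ofNat_ne_top := by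
  rw [natDilation, dif_neg hn]

/-- The junk value `D_0 = 0`. [folklore] -/
private theorem natDilation_zero : natDilation 0 = 0 := by
  rw [natDilation, dif_pos rfl]

/-- `D_1 = 1`. [cite: ConnesConsaniMoscovici2024, §4.2 eq. (44) p. 16 (arXiv chunk p0012:L74)] -/
theorem natDilation_one : natDilation 1 = 1 := by
  rw [natDilation_of_ne_zero one_ne_zero]
  exact (lpDilation_congr' Nat.cast_one _ one_ne_zero).trans (lpDilation_one _)

/-- **`D_{mn} = D_m D_n`** (`Γ_+ ∩ ℤ` is a monoid and `γ ↦ D_γ` a representation). [cite: ConnesConsaniMoscovici2024, §4.2 eq. (44) p. 16 (arXiv chunk p0012:L74–L81)] -/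
theorem natDilation_mul (m n : ℕ) : natDilation (m * n) = natDilation m * natDilation n := by
  by_cases hm : m = 0
  · rw [hm, zero_mul, natDilation_zero, zero_mul]
  by_cases hn : n = 0
  · rw [hn, mul_zero, natDilation_zero, mul_zero]
  rw [natDilation_of_ne_zero hm, natDilation_of_ne_zero hn, natDilation_of_ne_zero (mul_ne_zero hm hn),
    lpDilation_mul]
  exact lpDilation_congr' (by push_cast; ring) _ _

/-- `n ↦ D_n` as a monoid homomorphism `ℕ →* 𝓑(L²(ℝ))`. [cite: ConnesConsaniMoscovici2024, §4.2 eq. (44) p. 16 (arXiv chunk p0012:L74–L81)] -/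
def natDilationHom : ℕ →* (Lp ℂ 2 (volume : Measure ℝ) →L[ℂ] Lp ℂ 2 (volume : Measure ℝ)) where
  toFun := natDilation
  map_one' := natDilation_one
  map_mul' := natDilation_mul

/-- `natDilationHom n = D_n`. [folklore] -/
private theorem natDilationHom_apply (n : ℕ) : natDilationHom n = natDilation n := rfl

/-- For a prime, `D_p = primeDilation p`. [cite: ConnesConsaniMoscovici2024, §4.2 eq. (44) p. 16 (arXiv chunk p0012:L74)] -/
theorem natDilation_prime (q : ℕ) [hq : Fact q.Prime] : natDilation q = primeDilation q := by
  rw [natDilation_of_ne_zero hq.out.ne_zero]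
  rfl

/-- `D_{p^k} = D_p^k` (the terms of the single-prime `η_p = Σ_k D_p^k`). [cite: ConnesConsaniMoscovici2024, §4.2 eq. (44) p. 16 (arXiv chunk p0012:L74–L81)] -/
theorem natDilation_prime_pow (q : ℕ) [Fact q.Prime] (k : ℕ) : natDilation (q ^ k) = primeDilation q ^ k := by
  rw [← natDilation_prime, ← natDilationHom_apply, ← natDilationHom_apply, map_pow]

/-- **`‖D_n‖ ≤ n^{−1/2}`** (the `L²` scaling law `‖D_n f‖₂ = n^{−1/2}‖f‖₂`; this is why `η_S` is bounded but not
unitary). [cite: ConnesConsaniMoscovici2024, proof of Thm. 4.1 (ii) §4.3 p. 18 (arXiv chunk p0013:L52)] -/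
theorem norm_natDilation_le {n : ℕ} (hn : n ≠ 0) : ‖natDilation n‖ ≤ (n : ℝ) ^ (-(1 / 2 : ℝ)) := by
  have hn0 : (0 : ℝ) < n := by exact_mod_cast Nat.pos_of_ne_zero hn
  rw [natDilation_of_ne_zero hn]
  refine ContinuousLinearMap.opNorm_le_bound _ (by positivity) fun ξ => ?_
  rw [norm_lpDilation_apply]
  apply le_of_eq
  congr 1
  rw [Module.finrank_self, pow_one, abs_of_nonneg (inv_nonneg.2 hn0.le),
    show (1 / (2 : ℝ≥0∞)).toReal = (1 / 2 : ℝ) by simp, ← ENNReal.toReal_rpow,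
    ENNReal.toReal_ofReal (inv_nonneg.2 hn0.le), Real.inv_rpow hn0.le, Real.rpow_neg hn0.le]

/-- `½ − is ≠ 0`. [folklore] -/
private theorem half_sub_ne_zero (s : ℝ) : (1 / 2 - s * I : ℂ) ≠ 0 := by
  intro h
  have := congrArg Complex.re h
  simp at this

/-- `‖n^{−(½−is)}‖ = n^{−1/2}` for a positive integer `n`. [folklore] -/
private theorem norm_natCast_cpow_neg_half (s : ℝ) {n : ℕ} (hn : n ≠ 0) :
    ‖(n : ℂ) ^ (-(1 / 2 - s * I))‖ = (n : ℝ) ^ (-(1 / 2 : ℝ)) := by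
  rw [Complex.norm_natCast_cpow_of_pos (Nat.pos_of_ne_zero hn)]
  congr 1
  simp

/-- **The Euler product over `P` of the printed geometric series**: for a finite set `P` of primes,
`Σ_{n P-factored} n^{−(½−is)} = Π_{p ∈ P} (1 − p^{−(½−is)})⁻¹ = Π_{p ∈ P} L_p(½ − is)`, absolutely convergent
(Mathlib's `EulerProduct.summable_and_hasSum_factoredNumbers_prod_filter_prime_geometric` for the completely
multiplicative `n ↦ n^{−z}`). [cite: ConnesConsaniMoscovici2024, proof of Prop. 4.1 (i) §4.2 p. 17 (arXiv chunk p0012:L114–L121)] -/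
theorem summable_and_hasSum_cpow_factoredNumbers {P : Finset ℕ} (hP : ∀ p ∈ P, p.Prime) (s : ℝ) :
    Summable (fun n : Nat.factoredNumbers P => ‖((n : ℕ) : ℂ) ^ (-(1 / 2 - s * I))‖) ∧
      HasSum (fun n : Nat.factoredNumbers P => ((n : ℕ) : ℂ) ^ (-(1 / 2 - s * I)))
        (∏ p ∈ P, eulerFactor p (1 / 2 - s * I)) := by
  have h := EulerProduct.summable_and_hasSum_factoredNumbers_prod_filter_prime_geometric
    (f := (riemannZetaSummandHom (half_sub_ne_zero s) : ℕ →* ℂ)) (fun {p} hp => by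
      haveI : Fact p.Prime := ⟨hp⟩
      exact norm_prime_cpow_neg_lt_one p s) P
  rw [Finset.filter_true_of_mem hP] at h
  exact h

/-- `Σ_{n P-factored} ‖D_n‖ < ∞` (`‖D_n‖ ≤ n^{−1/2}` and the Euler product over `P`). [cite: ConnesConsaniMoscovici2024, §4.2 eq. (44) p. 16; proof of Thm. 4.1 (ii) p. 18 (arXiv chunk p0013:L52)] -/
theorem summable_norm_natDilation {P : Finset ℕ} (hP : ∀ p ∈ P, p.Prime) :
    Summable fun n : Nat.factoredNumbers P => ‖natDilation n‖ := by
  refine Summable.of_nonneg_of_le (fun _ => norm_nonneg _) (fun n => ?_)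
    (summable_and_hasSum_cpow_factoredNumbers hP 0).1
  have hn : (n : ℕ) ≠ 0 := Nat.ne_zero_of_mem_factoredNumbers n.2
  rw [norm_natCast_cpow_neg_half 0 hn]
  exact norm_natDilation_le hn

/-- **Eq. (44) as printed, for a general finite `S ∋ ∞`**: `η_S = Σ_{γ ∈ Γ_+ ∩ ℤ} D_γ`, the sum over the
`P`-factored positive integers converging (absolutely, in operator norm) to `Π_{p ∈ P} η_p` — "`η_S(f)(x) :=
Σ_{Γ_+} f(γx̃)` … `η_S(f)(1 × u) = Σ_{Γ_+ ∩ ℤ} f(γu)`".  PROVED (induction on `P`: the bijection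
`(e, m) ↦ p^e m`, `ℕ × F(P) ≃ F(P ∪ {p})`, and the product of the absolutely convergent series `Σ_k D_p^k` and
`Σ_{m ∈ F(P)} D_m`).  RH-FREE. [cite: ConnesConsaniMoscovici2024, §4.2 eq. (44) and the display after it, p. 16 (arXiv chunk p0012:L72–L81)] -/
theorem hasSum_natDilation_etaProd {P : Finset ℕ} (hP : ∀ p ∈ P, p.Prime) :
    HasSum (fun n : Nat.factoredNumbers P => natDilation n) (etaProd P) := by
  induction P using Finset.induction_on with
  | empty =>
    rw [Nat.factoredNumbers_empty, etaProd_empty]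
    have h := hasSum_singleton 1 natDilation
    rwa [natDilation_one] at h
  | insert a P ha ih =>
    have hP' : ∀ p ∈ P, p.Prime := fun p hp => hP p (Finset.mem_insert_of_mem hp)
    have hap : a.Prime := hP a (Finset.mem_insert_self a P)
    haveI : Fact a.Prime := ⟨hap⟩
    rw [etaProd_insert ha, etaAt_of_prime, ← (Nat.equivProdNatFactoredNumbers hap ha).hasSum_iff]
    have h2 : ((fun n : Nat.factoredNumbers (insert a P) => natDilation n) ∘
        (Nat.equivProdNatFactoredNumbers hap ha)) =
        fun x : ℕ × Nat.factoredNumbers P => primeDilation a ^ x.1 * natDilation x.2 := by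
      funext x
      rw [Function.comp_apply, Nat.equivProdNatFactoredNumbers_apply', natDilation_mul,
        natDilation_prime_pow]
    rw [h2]
    have ha0 : (0 : ℝ) < a := by exact_mod_cast hap.pos
    have ha1 : (1 : ℝ) < a := by exact_mod_cast hap.one_lt
    have hr0 : 0 ≤ (a : ℝ) ^ (-(1 / 2 : ℝ)) := by positivity
    have hr1 : (a : ℝ) ^ (-(1 / 2 : ℝ)) < 1 := Real.rpow_lt_one_of_one_lt_of_neg ha1 (by norm_num)
    have h1 : Summable fun k : ℕ => ‖primeDilation a ^ k‖ := by
      refine Summable.of_nonneg_of_le (fun _ => norm_nonneg _) (fun k => ?_)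
        (summable_geometric_of_lt_one hr0 hr1)
      rw [← natDilation_prime_pow]
      refine (norm_natDilation_le (pow_ne_zero k hap.ne_zero)).trans (le_of_eq ?_)
      have e : (((a ^ k : ℕ) : ℝ)) ^ (-(1 / 2 : ℝ)) = ((a : ℝ) ^ (-(1 / 2 : ℝ))) ^ k := by
        rw [Nat.cast_pow, ← Real.rpow_natCast _ k, ← Real.rpow_natCast _ k, ← Real.rpow_mul ha0.le,
          ← Real.rpow_mul ha0.le, mul_comm]
      exact e
    have : T3Space (Lp ℂ 2 (volume : Measure ℝ) →L[ℂ] Lp ℂ 2 (volume : Measure ℝ)) := inferInstance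
    apply (hasSum_semilocalEta a).mul (ih hP')
    apply summable_mul_of_summable_norm (f := fun k : ℕ => primeDilation a ^ k)
      (g := fun n : Nat.factoredNumbers P => natDilation n) h1 (summable_norm_natDilation hP')

/-- Eq. (44) on vectors: `η_S ξ = Σ_{n P-factored} D_n ξ` in `L²(ℝ)`. [cite: ConnesConsaniMoscovici2024, §4.2 eq. (44) p. 16 (arXiv chunk p0012:L74–L81)] -/
theorem hasSum_natDilation_apply_etaProd {P : Finset ℕ} (hP : ∀ p ∈ P, p.Prime)
    (ξ : Lp ℂ 2 (volume : Measure ℝ)) :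
    HasSum (fun n : Nat.factoredNumbers P => natDilation n ξ) (etaProd P ξ) := by
  have h := (hasSum_natDilation_etaProd hP).mapL
    (ContinuousLinearMap.apply ℂ (Lp ℂ 2 (volume : Measure ℝ)) ξ)
  simpa only [ContinuousLinearMap.apply_apply] using h

end FactoredNumbers

/-! ## Eqs. (45)–(47): `ℰ_S` and Proposition 4.1 (i) on the Mellin side, general finite `S` -/

section MellinSide

/-- **`η_S` at function level, general `S = {∞} ∪ P`**: `η_S(f)(1 × u) = Σ_{γ ∈ Γ_+ ∩ ℤ} f(γu)`, the sum over
the `P`-factored positive integers (display after eq. (44)); for `P = {p}` this is `primeSum p f`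
(`factoredSum_singleton`). [cite: ConnesConsaniMoscovici2024, §4.2 display after eq. (44) p. 16 (arXiv chunk p0012:L78–L81)] -/
def factoredSum (P : Finset ℕ) (f : ℝ → ℂ) (u : ℝ) : ℂ :=
  ∑' n : Nat.factoredNumbers P, f (((n : ℕ) : ℝ) * u)

/-- **`ℰ_S(f)(u) := u^{1/2} Σ_{Γ_+ ∩ ℤ} f(γu)`** (eq. (46)), general `S`, `u > 0`; `w_S(η_S(f)) = ℰ_S(f)` (eq. (45)).
[cite: ConnesConsaniMoscovici2024, §4.2 eqs. (45)–(46) p. 17 (arXiv chunk p0012:L85–L94)] -/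
def semilocalEOf (P : Finset ℕ) (f : ℝ → ℂ) (u : ℝ) : ℂ :=
  ((u : ℂ) ^ ((1 / 2 : ℂ))) * factoredSum P f u

/-- `S = {∞}`: `Γ_+ ∩ ℤ = {1}` and `η_∅(f) = f`. [cite: ConnesConsaniMoscovici2024, §4.2 eq. (44) p. 16] -/
theorem factoredSum_empty (f : ℝ → ℂ) (u : ℝ) : factoredSum ∅ f u = f u := by
  unfold factoredSum
  rw [Nat.factoredNumbers_empty]
  have h := (hasSum_singleton 1 fun n : ℕ => f ((n : ℝ) * u)).tsum_eq
  simp only [Set.restrict_apply, Nat.cast_one, one_mul] at h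
  exact h

/-- `S = {∞, p}`: `Γ_+ ∩ ℤ = {p^k}` and the general-`S` sum is the row file's `primeSum p`
(`Σ_k f(p^k u)`). [cite: ConnesConsaniMoscovici2024, §4.2 display after eq. (44) p. 16 (arXiv chunk p0012:L81); Rem. 4.2 (iii) eq. (50) p. 19 (chunk p0013:L77)] -/
theorem factoredSum_singleton (q : ℕ) [hq : Fact q.Prime] (f : ℝ → ℂ) (u : ℝ) :
    factoredSum {q} f u = primeSum q f u := by
  have hq' : q ∉ (∅ : Finset ℕ) := Finset.notMem_empty q
  -- `ℕ ≃ ℕ × F(∅) ≃ F({q})`, `k ↦ q^k`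
  let e0 : Nat.factoredNumbers (∅ : Finset ℕ) ≃ Unit :=
    (Equiv.setCongr Nat.factoredNumbers_empty).trans (Equiv.Set.singleton 1)
  let e : ℕ ≃ Nat.factoredNumbers (insert q (∅ : Finset ℕ)) :=
    ((Equiv.prodPUnit ℕ).symm.trans ((Equiv.refl ℕ).prodCongr e0.symm)).trans
      (Nat.equivProdNatFactoredNumbers hq.out hq')
  have hone : ∀ x : Nat.factoredNumbers (∅ : Finset ℕ), (x : ℕ) = 1 := fun x => by
    have hx : (x : ℕ) ∈ Nat.factoredNumbers ∅ := x.2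
    generalize (x : ℕ) = m at hx
    rw [Nat.factoredNumbers_empty] at hx
    exact hx
  have he : ∀ k : ℕ, ((e k : Nat.factoredNumbers (insert q (∅ : Finset ℕ))) : ℕ) = q ^ k := by
    intro k
    have h1 : ((e0.symm () : Nat.factoredNumbers (∅ : Finset ℕ)) : ℕ) = 1 := hone _
    change ((Nat.equivProdNatFactoredNumbers hq.out hq' (k, e0.symm ()) :
      Nat.factoredNumbers (insert q (∅ : Finset ℕ))) : ℕ) = q ^ k
    rw [Nat.equivProdNatFactoredNumbers_apply', h1, mul_one]
  have hins : ({q} : Finset ℕ) = insert q ∅ := (Finset.insert_empty).symm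
  unfold factoredSum primeSum
  rw [hins, ← e.tsum_eq]
  refine tsum_congr fun k => ?_
  rw [he, Nat.cast_pow]

/-- **Proposition 4.1 (i), eq. (47), for a general finite `S ∋ ∞`**, on the Mellin side: "`𝔽_μ(ℰ_S(f))(s) =
(Π_{p ∈ S∖{∞}} L_p(½ − is)) (𝔽_μ w_∞ f)(s)`" — `mellin (Σ_{n P-factored} f(n·)) (½ − is) = (Π_{p∈P} L_p(½ − is)) ·
mellin f (½ − is)` for every `f` whose Mellin integral converges absolutely on the critical line (`𝔽_μ ∘ w_∞ =
mellin · (½ − is)`, eqs. (18)–(19)).  The printed proof treats `S = {p, ∞}` "for simplicity" (termwise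
`∫₀^∞ f(p^ku)u^{½−is}d*u = p^{−k/2}p^{iks}∫₀^∞ f(v)v^{½−is}d*v` summed as a geometric series); the general case
is the same computation termwise over `Γ_+ ∩ ℤ`, `∫₀^∞ f(nu)u^{½−is}d*u = n^{−(½−is)} ∫₀^∞ f(v)v^{½−is}d*v`,
summed by the Euler product `Σ_{n P-factored} n^{−z} = Π_p (1 − p^{−z})⁻¹`, the interchange justified by
`Σ_n ∫|u^{−½−is}f(nu)|du = (Σ_n n^{−1/2}) ∫|u^{−½}f(u)|du < ∞`.  PROVED.  RH-FREE.
[cite: ConnesConsaniMoscovici2024, Prop. 4.1 (i) eq. (47) §4.2 p. 17 (arXiv chunk p0012:L96–L121)] -/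
theorem mellin_factoredSum {P : Finset ℕ} (hP : ∀ p ∈ P, p.Prime) {f : ℝ → ℂ} {s : ℝ}
    (hf : MellinConvergent f (1 / 2 - s * I)) :
    mellin (factoredSum P f) (1 / 2 - s * I) =
      (∏ p ∈ P, eulerFactor p (1 / 2 - s * I)) * mellin f (1 / 2 - s * I) := by
  set z : ℂ := 1 / 2 - s * I with hz
  have hzre : z.re = 1 / 2 := by simp [hz]
  have hn0 : ∀ n : Nat.factoredNumbers P, (0 : ℝ) < ((n : ℕ) : ℝ) := fun n => by
    exact_mod_cast Nat.pos_of_ne_zero (Nat.ne_zero_of_mem_factoredNumbers n.2)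
  -- the terms `G n t = t^{z-1} f(n t)` and the reference integrand `H t = ‖t^{z-1} f t‖`
  set G : Nat.factoredNumbers P → ℝ → ℂ := fun n t => ((t : ℝ) : ℂ) ^ (z - 1) • f (((n : ℕ) : ℝ) * t)
    with hG
  set H : ℝ → ℝ := fun u => ‖((u : ℝ) : ℂ) ^ (z - 1) • f u‖ with hH
  have hGi : ∀ n, IntegrableOn (G n) (Ioi 0) := fun n =>
    (MellinConvergent.comp_mul_left (hn0 n)).2 hf
  -- the integral of each term
  have hGint : ∀ n, ∫ t in Ioi 0, G n t = ((n : ℕ) : ℂ) ^ (-z) * mellin f z := by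
    intro n
    have h := mellin_comp_mul_left f z (hn0 n)
    rw [smul_eq_mul, Complex.ofReal_natCast] at h
    exact h
  -- the integral of the norm of each term: `∫‖G n‖ = n^{-1/2} ∫ H`
  have hGnorm : ∀ n, ∫ t in Ioi 0, ‖G n t‖ = (((n : ℕ) : ℝ) ^ (-(1 / 2) : ℝ)) * ∫ u in Ioi 0, H u := by
    intro n
    have ha0 : 0 < ((n : ℕ) : ℝ) := hn0 n
    have hpt : ∀ t ∈ Ioi (0 : ℝ), ‖G n t‖ = (((n : ℕ) : ℝ)) ^ (1 / 2 : ℝ) * H (((n : ℕ) : ℝ) * t) := by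
      intro t ht
      have ht0 : (0 : ℝ) < t := ht
      simp only [hG, hH, norm_smul, Complex.norm_cpow_eq_rpow_re_of_pos ht0,
        Complex.norm_cpow_eq_rpow_re_of_pos (mul_pos ha0 ht0), sub_re, one_re, hzre]
      rw [Real.mul_rpow ha0.le ht0.le, ← mul_assoc, ← mul_assoc, ← Real.rpow_add ha0,
        show (1 / 2 + (1 / 2 - 1) : ℝ) = 0 by norm_num, Real.rpow_zero, one_mul]
    rw [setIntegral_congr_fun measurableSet_Ioi hpt, integral_const_mul,
      integral_comp_mul_left_Ioi H 0 ha0, mul_zero, smul_eq_mul, ← mul_assoc]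
    congr 1
    rw [← Real.rpow_neg_one, ← Real.rpow_add ha0]
    norm_num
  -- summability of the norms (Euler product over `P`)
  have hsum : Summable fun n => ∫ t in Ioi 0, ‖G n t‖ := by
    simp_rw [hGnorm]
    refine Summable.mul_right _ ?_
    have h0 := (summable_and_hasSum_cpow_factoredNumbers hP 0).1
    refine h0.congr fun n => ?_
    rw [norm_natCast_cpow_neg_half 0 (Nat.ne_zero_of_mem_factoredNumbers n.2)]
  -- interchange of sum and integral
  have hswap := integral_tsum_of_summable_integral_norm (μ := volume.restrict (Ioi (0 : ℝ))) hGi hsum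
  -- pointwise: `Σ_n G n t = t^{z-1} · factoredSum P f t`
  have hpt : (fun t : ℝ => ∑' n, G n t) = fun t : ℝ => ((t : ℝ) : ℂ) ^ (z - 1) • factoredSum P f t := by
    funext t
    simp only [hG, factoredSum, smul_eq_mul]
    exact tsum_mul_left
  rw [hpt] at hswap
  -- assemble
  have hgeo : ∑' n : Nat.factoredNumbers P, ((n : ℕ) : ℂ) ^ (-z) = ∏ p ∈ P, eulerFactor p z :=
    (summable_and_hasSum_cpow_factoredNumbers hP s).2.tsum_eq
  calc mellin (factoredSum P f) z = ∫ t in Ioi 0, ((t : ℝ) : ℂ) ^ (z - 1) • factoredSum P f t := rfl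
    _ = ∑' n, ∫ t in Ioi 0, G n t := hswap.symm
    _ = ∑' n : Nat.factoredNumbers P, ((n : ℕ) : ℂ) ^ (-z) * mellin f z := tsum_congr hGint
    _ = (∑' n : Nat.factoredNumbers P, ((n : ℕ) : ℂ) ^ (-z)) * mellin f z := tsum_mul_right
    _ = (∏ p ∈ P, eulerFactor p z) * mellin f z := by rw [hgeo]

/-- **The multiplier `Π_{v ∈ S} L_v(½ − is)` of eq. (48) for a general finite `S = {∞} ∪ P`**:
`L_∞(½ − is) · Π_{p ∈ P} L_p(½ − is)` (`L_∞ = Complex.Gammaℝ`); `ℳ_S(f)(s) := (Π_v L_v(½ − is))⁻¹ f(s)`,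
`dm_S(s) := |Π_v L_v(½ − is)|² ds`.  For `P = {p}` this is the row file's `semilocalMultiplier p`
(`semilocalMultiplierOf_singleton`). [cite: ConnesConsaniMoscovici2024, §4.2 eq. (48) p. 18 (arXiv chunk p0012:L131–L135)] -/
def semilocalMultiplierOf (P : Finset ℕ) (s : ℝ) : ℂ :=
  Complex.Gammaℝ (1 / 2 - s * I) * ∏ p ∈ P, eulerFactor p (1 / 2 - s * I)

/-- `P = {p}`: agreement with `semilocalMultiplier p`. [cite: ConnesConsaniMoscovici2024, §4.2 eq. (48) p. 18] -/
theorem semilocalMultiplierOf_singleton (q : ℕ) [Fact q.Prime] (s : ℝ) :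
    semilocalMultiplierOf {q} s = semilocalMultiplier q s := by
  simp [semilocalMultiplierOf, semilocalMultiplier]

/-- **`ℳ_S`** (eq. (48)), general `S`: `ℳ_S(F)(s) := (Π_{v∈S} L_v(½ − is))⁻¹ F(s)`. [cite: ConnesConsaniMoscovici2024, §4.2 eq. (48) p. 18 (arXiv chunk p0012:L131–L135)] -/
def semilocalMOf (P : Finset ℕ) (F : ℝ → ℂ) (s : ℝ) : ℂ :=
  (semilocalMultiplierOf P s)⁻¹ * F s

/-- **The density `|Π_{v ∈ S} L_v(½ − is)|²` of `dm_S`** (eq. (48)), general `S`. [cite: ConnesConsaniMoscovici2024, §4.2 eq. (48) p. 18 (arXiv chunk p0012:L134)] -/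
def semilocalDensityOf (P : Finset ℕ) (s : ℝ) : ℝ :=
  ‖semilocalMultiplierOf P s‖ ^ 2

/-- **The measure `dm_S := |Π_{v∈S} L_v(½ − is)|² ds`** on `ℝ` (eq. (48)), general `S`. [cite: ConnesConsaniMoscovici2024, §4.2 eq. (48) p. 18 (arXiv chunk p0012:L134)] -/
def semilocalMeasureOf (P : Finset ℕ) : Measure ℝ :=
  volume.withDensity fun s => ENNReal.ofReal (semilocalDensityOf P s)

/-- **`𝒱_S := ℳ_S ∘ 𝒰_S`** (Prop. 4.2 (i)) at function level, general `S`, pulled back: `𝒱_S(f)(s) =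
(Π_v L_v(½ − is))⁻¹ · mellin f (½ − is)`. [cite: ConnesConsaniMoscovici2024, Prop. 4.2 (i) §4.2 p. 18 (arXiv chunk p0013:L3)] -/
def semilocalVOf (P : Finset ℕ) (f : ℝ → ℂ) (s : ℝ) : ℂ :=
  semilocalMOf P (fun s' => mellin f (1 / 2 - s' * I)) s

/-- **Proposition 4.3 (i) for a general finite `S ∋ ∞`**: "The map `ι_S` is bounded with bounded inverse" —
proof: "the function `Π_{p∈S∖{∞}} L_p(½ − is)` is bounded with bounded inverse, so that the Radon–Nikodym
derivatives `dm/dm_S` and `dm_S/dm` are both bounded."  Typed as exactly that two-sided bound, uniform in `s`: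
`Π_p (1 + p^{−1/2})⁻¹ ≤ |Π_{p∈P} L_p(½ − is)| ≤ Π_p (1 − p^{−1/2})⁻¹`.  PROVED (product of the single-prime
bounds `norm_eulerFactor_bounds`).  RH-FREE. [cite: ConnesConsaniMoscovici2024, Prop. 4.3 (i) §4.2 p. 18 (arXiv chunk p0013:L21, proof L36)] -/
theorem norm_prod_eulerFactor_bounds {P : Finset ℕ} (hP : ∀ p ∈ P, p.Prime) (s : ℝ) :
    ∏ p ∈ P, (1 + (Real.sqrt p)⁻¹)⁻¹ ≤ ‖∏ p ∈ P, eulerFactor p (1 / 2 - s * I)‖ ∧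
      ‖∏ p ∈ P, eulerFactor p (1 / 2 - s * I)‖ ≤ ∏ p ∈ P, (1 - (Real.sqrt p)⁻¹)⁻¹ := by
  rw [norm_prod]
  constructor
  · refine Finset.prod_le_prod (fun p _ => by positivity) fun p hp => ?_
    haveI : Fact p.Prime := ⟨hP p hp⟩
    exact (norm_eulerFactor_bounds p s).1
  · refine Finset.prod_le_prod (fun p _ => norm_nonneg _) fun p hp => ?_
    haveI : Fact p.Prime := ⟨hP p hp⟩
    exact (norm_eulerFactor_bounds p s).2

/-- `Π_{p∈P} L_p(½ − is) ≠ 0`. [cite: ConnesConsaniMoscovici2024, proof of Prop. 4.3 (i) §4.2 p. 18 (arXiv chunk p0013:L36)] -/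
theorem prod_eulerFactor_ne_zero {P : Finset ℕ} (hP : ∀ p ∈ P, p.Prime) (s : ℝ) :
    ∏ p ∈ P, eulerFactor p (1 / 2 - s * I) ≠ 0 :=
  Finset.prod_ne_zero_iff.mpr fun p hp => by
    haveI : Fact p.Prime := ⟨hP p hp⟩
    exact eulerFactor_ne_zero p s

/-- `Π_{v∈S} L_v(½ − is) ≠ 0`, general `S`. [cite: ConnesConsaniMoscovici2024, §4.2 eq. (48) p. 18 (arXiv chunk p0012:L134)] -/
theorem semilocalMultiplierOf_ne_zero {P : Finset ℕ} (hP : ∀ p ∈ P, p.Prime) (s : ℝ) :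
    semilocalMultiplierOf P s ≠ 0 := by
  unfold semilocalMultiplierOf
  refine mul_ne_zero (Complex.Gammaℝ_ne_zero_of_re_pos ?_) (prod_eulerFactor_ne_zero hP s)
  simp

/-- **Proposition 4.3 (ii) for a general finite `S ∋ ∞`** (diagram (49): `𝒱_S ∘ η_S = ι_S ∘ 𝒱`), pulled back and
at function level: `𝒱_S(η_S f) = ℳ(𝒰 f)`, i.e. `(L_∞ Π_p L_p)⁻¹ · mellin (Σ_{n P-factored} f(n·)) (½ − is) =
L_∞⁻¹ · mellin f (½ − is)` — "(ii) This follows from (47)".  PROVED.  RH-FREE.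
[cite: ConnesConsaniMoscovici2024, Prop. 4.3 (ii) diagram (49) §4.2 p. 18 (arXiv chunk p0013:L23–L36)] -/
theorem semilocalVOf_factoredSum {P : Finset ℕ} (hP : ∀ p ∈ P, p.Prime) {f : ℝ → ℂ} {s : ℝ}
    (hf : MellinConvergent f (1 / 2 - s * I)) :
    semilocalVOf P (factoredSum P f) s = (Complex.Gammaℝ (1 / 2 - s * I))⁻¹ * mellin f (1 / 2 - s * I) := by
  unfold semilocalVOf semilocalMOf semilocalMultiplierOf
  beta_reduce
  rw [mellin_factoredSum hP hf, mul_inv, mul_assoc,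
    ← mul_assoc (∏ p ∈ P, eulerFactor p (1 / 2 - s * I))⁻¹,
    inv_mul_cancel₀ (prod_eulerFactor_ne_zero hP s), one_mul]

/-- **`ξ_S := η_S(ξ_∞)`** (Prop. 4.2 (i)), general `S`, pulled back: `ξ_S = η_S h₀`; for `P = {p}` the row file's
`semilocalXi p`. [cite: ConnesConsaniMoscovici2024, Prop. 4.2 (i) §4.2 p. 18 (arXiv chunk p0013:L3); Rem. 4.2 (ii) p. 19 (chunk p0013:L52)] -/
def semilocalXiOf (P : Finset ℕ) : Lp ℂ 2 (volume : Measure ℝ) :=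
  etaProd P gaussianVec

/-- `P = {p}`: `ξ_{{p}} = ξ_p`. [cite: ConnesConsaniMoscovici2024, Prop. 4.2 (i) §4.2 p. 18] -/
theorem semilocalXiOf_singleton (q : ℕ) [Fact q.Prime] : semilocalXiOf {q} = semilocalXi q := by
  rw [semilocalXiOf, etaProd_singleton]
  rfl

/-- **Proposition 4.2 (ii), general `S`, first clause PROVED**: "[`𝔽_S`] fixes the vector `ξ` by Prop. 4.1" —
`𝔽_S ξ_S = ξ_S` (`𝔽_S η_S h₀ = η_S 𝓕 h₀ = η_S h₀`).  RH-FREE.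
[cite: ConnesConsaniMoscovici2024, Prop. 4.2 (ii) §4.2 p. 18 (arXiv chunk p0013:L5, proof L17)] -/
theorem semilocalFourierOf_semilocalXiOf (P : Finset ℕ) :
    semilocalFourierOf P (semilocalXiOf P) = semilocalXiOf P := by
  rw [semilocalXiOf, semilocalFourierOf_etaProd, fourier_gaussianVec]

/-- **Proposition 4.2 (ii), general `S`, second clause PROVED**: "the Fourier transform `𝔽_S` anticommutes with
`ϑ_S`" — at the level of the scaling group, `𝔽_S ∘ D_a = |a|⁻¹D_{a⁻¹} ∘ 𝔽_S` for every dilation, i.e.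
`𝔽_S ϑ(λ) = ϑ(λ⁻¹) 𝔽_S` for `ϑ(λ) = λ^{−1/2}D_{λ⁻¹}` (CC 2021 eq. (40)).  RH-FREE.
[cite: ConnesConsaniMoscovici2024, proof of Prop. 4.2 (ii) §4.2 p. 18 (arXiv chunk p0013:L17)] -/
theorem semilocalFourierOf_lpDilation {a : ℝ} (ha : a ≠ 0) (P : Finset ℕ) (ξ : Lp ℂ 2 (volume : Measure ℝ)) :
    semilocalFourierOf P (lpDilation (V := ℝ) (F := ℂ) (p := (2 : ℝ≥0∞)) a ha ENNReal.ofNat_ne_top ξ) =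
      ((|a|⁻¹ : ℝ) : ℂ) • lpDilation (V := ℝ) (F := ℂ) (p := (2 : ℝ≥0∞)) a⁻¹ (inv_ne_zero ha)
        ENNReal.ofNat_ne_top (semilocalFourierOf P ξ) := by
  have h1 : (↑(twistProdUnit P)⁻¹ : Lp ℂ 2 (volume : Measure ℝ) →L[ℂ] Lp ℂ 2 (volume : Measure ℝ))
      (lpDilation (V := ℝ) (F := ℂ) (p := (2 : ℝ≥0∞)) a ha ENNReal.ofNat_ne_top ξ) =
      lpDilation (V := ℝ) (F := ℂ) (p := (2 : ℝ≥0∞)) a ha ENNReal.ofNat_ne_top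
        ((↑(twistProdUnit P)⁻¹ : Lp ℂ 2 (volume : Measure ℝ) →L[ℂ] Lp ℂ 2 (volume : Measure ℝ)) ξ) :=
    (congrArg (fun T : Lp ℂ 2 (volume : Measure ℝ) →L[ℂ] Lp ℂ 2 (volume : Measure ℝ) => T ξ)
      (commute_lpDilation_twistProdUnit_inv ha P).eq).symm
  have h2 : ∀ v : Lp ℂ 2 (volume : Measure ℝ), twistProd P
      (lpDilation (V := ℝ) (F := ℂ) (p := (2 : ℝ≥0∞)) a⁻¹ (inv_ne_zero ha) ENNReal.ofNat_ne_top v) =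
      lpDilation (V := ℝ) (F := ℂ) (p := (2 : ℝ≥0∞)) a⁻¹ (inv_ne_zero ha) ENNReal.ofNat_ne_top
        (twistProd P v) := fun v =>
    (congrArg (fun T : Lp ℂ 2 (volume : Measure ℝ) →L[ℂ] Lp ℂ 2 (volume : Measure ℝ) => T v)
      (commute_lpDilation_twistProd (inv_ne_zero ha) P).eq).symm
  change twistProd P (fourierL2 ((↑(twistProdUnit P)⁻¹ : Lp ℂ 2 (volume : Measure ℝ) →L[ℂ]
      Lp ℂ 2 (volume : Measure ℝ)) (lpDilation (V := ℝ) (F := ℂ) (p := (2 : ℝ≥0∞)) a ha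
        ENNReal.ofNat_ne_top ξ))) = _
  rw [h1, fourierL2_eq_fourier, fourier_lpDilation ha, RCLike.real_smul_eq_coe_smul (K := ℂ), map_smul, h2]
  rfl

/-- **Proposition 4.1 (ii) for a general finite `S ∋ ∞`**, pulled back: "`η_S(P_λ) ⊂ P_λ^S` where `P_λ^S` is the
subspace of `L²(X_S)^{K_S}` of functions with support in `{x | |x| ≤ λ}`" — `η_S` maps `P_λ` into `P_λ`.  PROVED
(factorwise from the single-prime `semilocalEta_mem_cutoffSpace`).  RH-FREE.
[cite: ConnesConsaniMoscovici2024, Prop. 4.1 (ii) §4.2 p. 17 (arXiv chunk p0012:L104, proof L123–L126)] -/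
theorem etaProd_mem_cutoffSpace (P : Finset ℕ) {lam : ℝ} {ξ : Lp ℂ 2 (volume : Measure ℝ)}
    (hξ : ξ ∈ cutoffSpace lam) : etaProd P ξ ∈ cutoffSpace lam := by
  unfold etaProd
  suffices h : ∀ l : List ℕ, (l.map etaAt).prod ξ ∈ cutoffSpace lam from h _
  intro l
  induction l with
  | nil => simpa using hξ
  | cons a l ih =>
    rw [List.map_cons, List.prod_cons]
    change etaAt a ((l.map etaAt).prod ξ) ∈ cutoffSpace lam
    by_cases ha : a.Prime
    · haveI : Fact a.Prime := ⟨ha⟩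
      rw [etaAt_of_prime]
      exact semilocalEta_mem_cutoffSpace a ih
    · rw [etaAt_of_not_prime ha]
      exact ih

/-- **Proposition 4.1 (iv) for a general finite `S ∋ ∞`**, pulled back: "`η_S(P̂_λ) ⊂ P̂_λ^S` where `P̂_λ`, `P̂_λ^S`
are the images of `P_λ`, `P_λ^S` by the Fourier transform" — `η_S(𝓕 P_λ) ⊆ 𝔽_S(P_λ)`; "(iv) Follows from (ii)
and (iii)".  PROVED.  RH-FREE. [cite: ConnesConsaniMoscovici2024, Prop. 4.1 (iv) §4.2 p. 17 (arXiv chunk p0012:L110, proof L128)] -/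
theorem etaProd_fourier_mem_semilocalFourierOf_cutoffSpace (P : Finset ℕ) {lam : ℝ}
    {ζ : Lp ℂ 2 (volume : Measure ℝ)} (hζ : ζ ∈ cutoffSpace lam) :
    ∃ ζ' ∈ cutoffSpace lam,
      etaProd P (𝓕 ζ : Lp ℂ 2 (volume : Measure ℝ)) = semilocalFourierOf P ζ' :=
  ⟨etaProd P ζ, etaProd_mem_cutoffSpace P hζ, (semilocalFourierOf_etaProd P ζ).symm⟩

end MellinSide

/-! ## §4.4 and §4.7 on the Mellin side for a general finite `S`: `E_S`, `β_S`, `υ_S`, eq. (58), Prop. 4.7 (ii) -/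

section DualGeneral

/-- **`E_S(s) := Π_{v∈S} L_v(½ + is)`** (eq. (51)), general `S = {∞} ∪ P` (`E_∞ = L_∞(½ + is) =
archDualMultiplier`); for `P = {p}` the row file's `dualMultiplier p`. [cite: ConnesConsaniMoscovici2024, §4.4 eq. (51) p. 19 (arXiv chunk p0013:L89)] -/
def dualMultiplierOf (P : Finset ℕ) (s : ℝ) : ℂ :=
  Complex.Gammaℝ (1 / 2 + s * I) * ∏ p ∈ P, eulerFactor p (1 / 2 + s * I)

/-- `P = {p}`: agreement with `dualMultiplier p`. [cite: ConnesConsaniMoscovici2024, §4.4 eq. (51) p. 19] -/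
theorem dualMultiplierOf_singleton (q : ℕ) [Fact q.Prime] (s : ℝ) :
    dualMultiplierOf {q} s = dualMultiplier q s := by
  simp [dualMultiplierOf, dualMultiplier]

/-- `P = ∅`: `E_∅ = E_∞`. [cite: ConnesConsaniMoscovici2024, §4.4 eq. (51) p. 19; Prop. 4.7 (ii) p. 22 (arXiv chunk p0015:L44)] -/
theorem dualMultiplierOf_empty (s : ℝ) : dualMultiplierOf ∅ s = archDualMultiplier s := by
  simp [dualMultiplierOf, archDualMultiplier]

/-- **`β_S`** (eq. (52)), general `S`: `β_S(F)(s) := (Π_{v∈S} L_v(½ + is)) F(s)`. [cite: ConnesConsaniMoscovici2024, §4.4 eq. (52) p. 20 (arXiv chunk p0013:L93)] -/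
def betaMulOf (P : Finset ℕ) (F : ℝ → ℂ) (s : ℝ) : ℂ :=
  dualMultiplierOf P s * F s

/-- **The measure `ds/|E_S(s)|²`** (§4.4), general `S`. [cite: ConnesConsaniMoscovici2024, §4.4 p. 20 (arXiv chunk p0013:L91)] -/
def dualMeasureOf (P : Finset ℕ) : Measure ℝ :=
  volume.withDensity fun s => ENNReal.ofReal ((‖dualMultiplierOf P s‖ ^ 2)⁻¹)

/-- **Definition 4.3 — the dual Hardy–Titchmarsh transform `υ_S := β_S ∘ 𝒰_S`** (eq. (53)), general `S`, pulled
back and at function level: `υ_S(f)(s) = E_S(s) · mellin f (½ − is)`; for `P = {p}` the row file's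
`dualTransform p`, for `P = ∅` its `archDualTransform`. [cite: ConnesConsaniMoscovici2024, Def. 4.3 eq. (53) §4.4 p. 20 (arXiv chunk p0013:L97–L101)] -/
def dualTransformOf (P : Finset ℕ) (f : ℝ → ℂ) (s : ℝ) : ℂ :=
  betaMulOf P (fun s' => mellin f (1 / 2 - s' * I)) s

/-- `P = {p}`: agreement with `dualTransform p`. [cite: ConnesConsaniMoscovici2024, Def. 4.3 §4.4 p. 20] -/
theorem dualTransformOf_singleton (q : ℕ) [Fact q.Prime] (f : ℝ → ℂ) (s : ℝ) :
    dualTransformOf {q} f s = dualTransform q f s := by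
  simp [dualTransformOf, dualTransform, betaMulOf, betaMul, dualMultiplierOf_singleton]

/-- `P = ∅`: `υ_∅ = υ_∞`. [cite: ConnesConsaniMoscovici2024, Def. 4.3 §4.4 p. 20; Prop. 4.7 (ii) p. 22] -/
theorem dualTransformOf_empty (f : ℝ → ℂ) (s : ℝ) : dualTransformOf ∅ f s = archDualTransform f s := by
  simp [dualTransformOf, archDualTransform, betaMulOf, dualMultiplierOf_empty]

/-- **`conj (Π_{v∈S} L_v(½ − is)) = E_S(s)`**, general `S` — "the equality valid for any place `v` and `s ∈ ℝ`,
`conj L_v(½ + is) = L_v(½ − is)`" multiplied over `S`; the identity behind Prop. 4.4.  PROVED.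
[cite: ConnesConsaniMoscovici2024, proof of Prop. 4.4 §4.4 p. 20 (arXiv chunk p0014:L3–L9)] -/
theorem conj_semilocalMultiplierOf (P : Finset ℕ) (s : ℝ) :
    conj (semilocalMultiplierOf P s) = dualMultiplierOf P s := by
  unfold semilocalMultiplierOf dualMultiplierOf
  rw [map_mul, map_prod, ← conj_Gammaℝ_half_add, Complex.conj_conj]
  congr 1
  exact Finset.prod_congr rfl fun p _ => by rw [← conj_eulerFactor, Complex.conj_conj]

/-- `|E_S(s)| = |Π_v L_v(½ − is)|`, general `S`. [cite: ConnesConsaniMoscovici2024, §4.4 p. 20 (arXiv chunk p0013:L91, p0014:L9)] -/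
theorem norm_dualMultiplierOf (P : Finset ℕ) (s : ℝ) : ‖dualMultiplierOf P s‖ = ‖semilocalMultiplierOf P s‖ := by
  rw [← conj_semilocalMultiplierOf, Complex.norm_conj]

/-- **Proposition 4.4 (ii) for a general finite `S ∋ ∞`**, pulled back and at function level: "For any
`ξ, η ∈ L²(X_S)^{K_S}` one has `⟨υ_Sξ | 𝒱_Sη⟩_ℝ = ⟨ξ|η⟩`" — the integrand of `⟨υ_S f | 𝒱_S g⟩_ℝ` equals
`𝒰f · conj(𝒰g)` pointwise, because `E_S(s)/conj(Π_v L_v(½ − is)) = 1`; the remaining step `⟨𝒰f|𝒰g⟩ = ⟨f|g⟩` is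
the unitarity of `𝒰_S` (Mellin–Plancherel) and is not asserted.  PROVED.  RH-FREE.
[cite: ConnesConsaniMoscovici2024, Prop. 4.4 (ii) §4.4 p. 20 (arXiv chunk p0014:L1–L9)] -/
theorem dualTransformOf_mul_conj_semilocalVOf {P : Finset ℕ} (hP : ∀ p ∈ P, p.Prime) (f g : ℝ → ℂ) (s : ℝ) :
    dualTransformOf P f s * conj (semilocalVOf P g s) =
      mellin f (1 / 2 - s * I) * conj (mellin g (1 / 2 - s * I)) := by
  unfold dualTransformOf betaMulOf semilocalVOf semilocalMOf
  beta_reduce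
  rw [map_mul, map_inv₀, conj_semilocalMultiplierOf]
  have hE : dualMultiplierOf P s ≠ 0 := by
    rw [← conj_semilocalMultiplierOf]
    exact (map_ne_zero _).mpr (semilocalMultiplierOf_ne_zero hP s)
  field_simp

/-- **`θ_S` at function level, general `S = {∞} ∪ P`**: the composite of the single-prime `(θ_p f)(u) = f(u) −
p⁻¹f(u/p)` (`primeTwistFun`) along the increasing enumeration of `P` — the position-space form of
`w_S(σ_S ⊗ f)` (proof of Prop. 4.6 (ii)). [cite: ConnesConsaniMoscovici2024, proof of Prop. 4.6 (ii) §4.6 p. 22 (arXiv chunk p0015:L1–L30)] -/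
def twistFunProd (P : Finset ℕ) (f : ℝ → ℂ) : ℝ → ℂ :=
  (P.sort (· ≤ ·)).foldr (fun p g => primeTwistFun p g) f

/-- `θ_∅ f = f` at function level. [cite: ConnesConsaniMoscovici2024, proof of Prop. 4.6 (ii) §4.6 p. 22] -/
theorem twistFunProd_empty (f : ℝ → ℂ) : twistFunProd ∅ f = f := by
  simp [twistFunProd]

/-- `θ_{{p}} f = θ_p f` at function level. [cite: ConnesConsaniMoscovici2024, proof of Prop. 4.6 (ii) §4.6 p. 22] -/
theorem twistFunProd_singleton (q : ℕ) (f : ℝ → ℂ) : twistFunProd {q} f = primeTwistFun q f := by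
  simp [twistFunProd]

/-- `θ_p` at function level preserves absolute Mellin convergence on the critical line. [cite: ConnesConsaniMoscovici2024, §4.7 eq. (58) p. 22 (arXiv chunk p0015:L34–L38)] -/
theorem mellinConvergent_primeTwistFun {q : ℕ} (hq : q.Prime) {f : ℝ → ℂ} {z : ℂ} (hf : MellinConvergent f z) :
    MellinConvergent (primeTwistFun q f) z := by
  have hqi : (0 : ℝ) < (q : ℝ)⁻¹ := inv_pos.2 (by exact_mod_cast hq.pos)
  have hdil : MellinConvergent (fun t => f ((q : ℝ)⁻¹ * t)) z := (MellinConvergent.comp_mul_left hqi).2 hf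
  have h := (hasMellin_sub hf (hdil.const_smul ((q : ℂ)⁻¹))).1
  simp only [smul_eq_mul] at h
  exact h

/-- `θ_S` at function level preserves absolute Mellin convergence (list form). [cite: ConnesConsaniMoscovici2024, §4.7 eq. (58) p. 22] -/
theorem mellinConvergent_foldr_primeTwistFun {l : List ℕ} (hl : ∀ q ∈ l, q.Prime) {f : ℝ → ℂ} {z : ℂ}
    (hf : MellinConvergent f z) :
    MellinConvergent (l.foldr (fun p g => primeTwistFun p g) f) z := by
  induction l with
  | nil => simpa using hf
  | cons a l ih =>
    rw [List.foldr_cons]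
    exact mellinConvergent_primeTwistFun (hl a (by simp))
      (ih fun q hq => hl q (List.mem_cons_of_mem a hq))

/-- Eq. (58) in list form: `mellin (θ_l f) (½ − is) = (Π_{p ∈ l} L_p(½ + is))⁻¹ · mellin f (½ − is)`. [cite: ConnesConsaniMoscovici2024, §4.7 eq. (58) p. 22 (arXiv chunk p0015:L34–L38)] -/
theorem mellin_foldr_primeTwistFun {l : List ℕ} (hl : ∀ q ∈ l, q.Prime) {f : ℝ → ℂ} {s : ℝ}
    (hf : MellinConvergent f (1 / 2 - s * I)) :
    mellin (l.foldr (fun p g => primeTwistFun p g) f) (1 / 2 - s * I) =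
      ((l.map fun p => eulerFactor p (1 / 2 + s * I)).prod)⁻¹ * mellin f (1 / 2 - s * I) := by
  induction l with
  | nil => simp
  | cons a l ih =>
    have ha : a.Prime := hl a (by simp)
    haveI : Fact a.Prime := ⟨ha⟩
    have hl' : ∀ q ∈ l, q.Prime := fun q hq => hl q (List.mem_cons_of_mem a hq)
    rw [List.foldr_cons, mellin_primeTwistFun a (mellinConvergent_foldr_primeTwistFun hl' hf), ih hl',
      List.map_cons, List.prod_cons, mul_inv, mul_assoc]

/-- **Eq. (58) for a general finite `S ∋ ∞`** (≡ Prop. 4.6 (ii) eq. (57) rewritten with `(1 − p^{−½−is})⁻¹ =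
L_p(½ + is)`): "`𝔽_μ w_S(θ_S(f))(s) = (Π_{p∈S∖{∞}} L_p(½ + is))⁻¹ (𝔽_μ w_∞ f)(s)`", on the Mellin side:
`mellin (θ_S f) (½ − is) = (Π_{p∈P} L_p(½ + is))⁻¹ · mellin f (½ − is)` for `f` with absolutely convergent Mellin
integral there.  PROVED (factorwise from the single-prime `mellin_primeTwistFun`).  RH-FREE.
[cite: ConnesConsaniMoscovici2024, §4.7 eq. (58) p. 22 (arXiv chunk p0015:L34–L38); Prop. 4.6 (ii) eq. (57) (chunk p0014:L89–L93)] -/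
theorem mellin_twistFunProd {P : Finset ℕ} (hP : ∀ p ∈ P, p.Prime) {f : ℝ → ℂ} {s : ℝ}
    (hf : MellinConvergent f (1 / 2 - s * I)) :
    mellin (twistFunProd P f) (1 / 2 - s * I) =
      (∏ p ∈ P, eulerFactor p (1 / 2 + s * I))⁻¹ * mellin f (1 / 2 - s * I) := by
  have hl : ∀ q ∈ P.sort (· ≤ ·), q.Prime := fun q hq => hP q (by simpa only [Finset.mem_sort] using hq)
  rw [twistFunProd, mellin_foldr_primeTwistFun hl hf]
  congr 2
  have h := List.prod_toFinset (fun p : ℕ => eulerFactor p (1 / 2 + s * I)) (Finset.sort_nodup P (· ≤ ·))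
  rw [Finset.sort_toFinset] at h
  rw [← h]

/-- **Proposition 4.7 (ii) for a general finite `S ∋ ∞`** (diagram (59): `υ_S ∘ θ_S = ι'_S ∘ υ_∞`), pulled back
and at function level: "`υ_S ∘ θ_S(f)(s) = (Π_{v∈S} L_v(½+is))(Π_{p∈S∖{∞}} L_p(½+is))⁻¹(𝔽_μ w_∞ f)(s) =
L_∞(½+is)(𝔽_μ w_∞ f)(s) = υ_∞(f)(s)`" — `υ_S(θ_S f) = υ_∞(f)` on the critical line, for `f` with absolutely
convergent Mellin integral.  PROVED from eq. (58).  RH-FREE.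
[cite: ConnesConsaniMoscovici2024, Prop. 4.7 (ii) diagram (59) §4.7 p. 22 (arXiv chunk p0015:L44–L56, proof L60–L68)] -/
theorem dualTransformOf_twistFunProd {P : Finset ℕ} (hP : ∀ p ∈ P, p.Prime) {f : ℝ → ℂ} {s : ℝ}
    (hf : MellinConvergent f (1 / 2 - s * I)) :
    dualTransformOf P (twistFunProd P f) s = archDualTransform f s := by
  unfold dualTransformOf betaMulOf archDualTransform dualMultiplierOf archDualMultiplier
  beta_reduce
  rw [mellin_twistFunProd hP hf]
  have hne : ∏ p ∈ P, eulerFactor p (1 / 2 + s * I) ≠ 0 := by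
    have h := prod_eulerFactor_ne_zero hP (-s)
    rwa [show (1 / 2 - ((-s : ℝ) : ℂ) * I) = 1 / 2 + s * I by push_cast; ring] at h
  rw [← mul_assoc, mul_assoc (Complex.Gammaℝ _), mul_inv_cancel₀ hne, mul_one]

end DualGeneral

/-! ## `𝔽_S` is unitary (Connes 1999 §VII Lemma 1 b); CCM 2024 Prop. 4.2 (ii) / Prop. 4.7) — the adjoint `θ_S^* = η_S⁻¹`

The tree's pulled-back `𝔽_S = θ_S 𝔽_{e_ℝ} θ_S⁻¹` (`Connes2026.semilocalFourierOf`, and `semilocalFourier p` for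
`S = {∞, p}`) was introduced with "unitarity not proved here".  It IS unitary on `L²(ℝ)`, by pure algebra from
what precedes: `θ_p^* = 1 − D_p = η_p⁻¹` (`inner_primeTwist_left`), hence `θ_S^* = η_S⁻¹` and `θ_S^*θ_S =
η_S⁻¹θ_S` COMMUTES WITH `𝓕` (`commute_fourierL2_etaInvProd_mul_twistProd`); so for `a = θ_S⁻¹ξ`, `b = θ_S⁻¹η`:
`⟪𝔽_S ξ, 𝔽_S η⟫ = ⟪θ_S𝓕a, θ_S𝓕b⟫ = ⟪𝓕a, θ_S^*θ_S 𝓕b⟫ = ⟪𝓕a, 𝓕 θ_S^*θ_S b⟫ = ⟪a, θ_S^*θ_S b⟫ = ⟪θ_S a, θ_S b⟫ = ⟪ξ, η⟫`.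
This is the `K_S`-invariant shadow of "`F` extends to a unitary operator on `L²(X_S)`" (Connes 1999 §VII
Lemma 1 b)) and makes the ultraviolet cutoff `P̂_Λ = 𝔽_S P_Λ 𝔽_S⁻¹` (`Connes2026.dualCutoffProj`) an ORTHOGONAL
projection, as Connes 1999 §VII (13) requires. -/

section Unitary

/-- **`θ_S^* = η_S⁻¹`**: `⟪θ_S f, g⟫ = ⟪f, (Π_p (1 − D_p)) g⟫` (factorwise `θ_p^* = 1 − D_p`, the adjoint of a dilation).
[cite: ConnesConsaniMoscovici2024, proof of Prop. 4.7 (iii) §4.7 p. 23 (arXiv chunk p0015:L70–L81)] -/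
theorem inner_twistProd_left (P : Finset ℕ) (f g : Lp ℂ 2 (volume : Measure ℝ)) :
    ⟪twistProd P f, g⟫_ℂ = ⟪f, etaInvProd P g⟫_ℂ := by
  induction P using Finset.induction_on generalizing f g with
  | empty => simp [twistProd_empty, etaInvProd, Finset.sort_empty]
  | insert a P ha ih =>
    rw [twistProd_insert ha, etaInvProd_insert ha]
    have hc : etaInvAt a * etaInvProd P = etaInvProd P * etaInvAt a :=
      (Commute.list_prod_right _ _ fun x hx => by
        obtain ⟨n, -, rfl⟩ := List.mem_map.mp hx
        exact commute_etaInvAt_etaInvAt a n).eq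
    rw [hc]
    by_cases hap : a.Prime
    · haveI : Fact a.Prime := ⟨hap⟩
      rw [twistAt_of_prime, etaInvAt_of_prime]
      change ⟪primeTwist a (twistProd P f), g⟫_ℂ = ⟪f, etaInvProd P ((1 - primeDilation a) g)⟫_ℂ
      rw [inner_primeTwist_left, ih]
      rfl
    · rw [twistAt_of_not_prime hap, etaInvAt_of_not_prime hap, one_mul, mul_one]
      exact ih f g

/-- **The adjoint of `θ_S` is `η_S⁻¹ = Π_p (1 − D_p)`.** [cite: ConnesConsaniMoscovici2024, proof of Prop. 4.7 (iii) §4.7 p. 23 (arXiv chunk p0015:L70–L81)] -/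
theorem adjoint_twistProd (P : Finset ℕ) :
    ContinuousLinearMap.adjoint (twistProd P) = etaInvProd P := by
  symm
  rw [ContinuousLinearMap.eq_adjoint_iff]
  intro x y
  rw [← inner_conj_symm, ← inner_twistProd_left, inner_conj_symm]

/-- **`𝔽_S` preserves the inner product of `L²(ℝ)`** (pull-back of "`F` extends to a unitary operator on
`L²(X_S)`", Connes 1999 §VII Lemma 1 b); CCM 2024 use `𝔽_S` as the unitary grading of the even cyclic pair,
Prop. 4.2 (ii)).  PROVED: `θ_S^*θ_S = η_S⁻¹θ_S` commutes with `𝓕` and `𝓕` is unitary.  RH-FREE.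
[cite: Connes1999, §VII Lemma 1 b) (arXiv p0012); ConnesConsaniMoscovici2024, Prop. 4.2 (ii) §4.2 p. 18 (arXiv chunk p0013:L5)] -/
theorem inner_semilocalFourierOf (P : Finset ℕ) (ξ η : Lp ℂ 2 (volume : Measure ℝ)) :
    ⟪semilocalFourierOf P ξ, semilocalFourierOf P η⟫_ℂ = ⟪ξ, η⟫_ℂ := by
  set Tinv : Lp ℂ 2 (volume : Measure ℝ) →L[ℂ] Lp ℂ 2 (volume : Measure ℝ) := ↑(twistProdUnit P)⁻¹ with hTinv
  have hT : ∀ v, twistProd P (Tinv v) = v := fun v =>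
    congrArg (fun T : Lp ℂ 2 (volume : Measure ℝ) →L[ℂ] Lp ℂ 2 (volume : Measure ℝ) => T v)
      (twistProd_mul_inv P)
  have hB : ∀ v, fourierL2 ((etaInvProd P * twistProd P) v) = (etaInvProd P * twistProd P) (fourierL2 v) :=
    fun v => congrArg (fun T : Lp ℂ 2 (volume : Measure ℝ) →L[ℂ] Lp ℂ 2 (volume : Measure ℝ) => T v)
      (commute_fourierL2_etaInvProd_mul_twistProd P).eq
  have hF : ∀ a b : Lp ℂ 2 (volume : Measure ℝ), ⟪fourierL2 a, fourierL2 b⟫_ℂ = ⟪a, b⟫_ℂ := fun a b =>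
    (Lp.fourierTransformₗᵢ ℝ ℂ).inner_map_map a b
  calc ⟪semilocalFourierOf P ξ, semilocalFourierOf P η⟫_ℂ
      = ⟪twistProd P (fourierL2 (Tinv ξ)), twistProd P (fourierL2 (Tinv η))⟫_ℂ := rfl
    _ = ⟪fourierL2 (Tinv ξ), (etaInvProd P * twistProd P) (fourierL2 (Tinv η))⟫_ℂ := by
        rw [inner_twistProd_left]; rfl
    _ = ⟪fourierL2 (Tinv ξ), fourierL2 ((etaInvProd P * twistProd P) (Tinv η))⟫_ℂ := by rw [hB]
    _ = ⟪Tinv ξ, (etaInvProd P * twistProd P) (Tinv η)⟫_ℂ := hF _ _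
    _ = ⟪twistProd P (Tinv ξ), twistProd P (Tinv η)⟫_ℂ := by rw [inner_twistProd_left]; rfl
    _ = ⟪ξ, η⟫_ℂ := by rw [hT, hT]

/-- **`𝔽_S` is an isometry of `L²(ℝ)`**: `‖𝔽_S ξ‖ = ‖ξ‖`. [cite: Connes1999, §VII Lemma 1 b) (arXiv p0012)] -/
theorem norm_semilocalFourierOf (P : Finset ℕ) (ξ : Lp ℂ 2 (volume : Measure ℝ)) :
    ‖semilocalFourierOf P ξ‖ = ‖ξ‖ := by
  rw [norm_eq_sqrt_re_inner (𝕜 := ℂ), norm_eq_sqrt_re_inner (𝕜 := ℂ), inner_semilocalFourierOf]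

/-- `𝔽_S` is invertible (two-sided inverse `𝔽_S⁻¹ = θ_S 𝓕⁻¹ θ_S⁻¹`). [cite: Connes1999, §VII Lemma 1 b) (arXiv p0012)] -/
theorem isUnit_semilocalFourierOf (P : Finset ℕ) : IsUnit (semilocalFourierOf P) :=
  ⟨⟨semilocalFourierOf P, semilocalFourierInvOf P, semilocalFourierOf_mul_inv P, semilocalFourierInvOf_mul P⟩,
    rfl⟩

/-- **`𝔽_S` is a unitary of `L²(ℝ)`** — the pull-back to `L²(X_S)^{K_S} ≅ L²(ℝ)_ev` (extended to all of `L²(ℝ)`)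
of Connes 1999 §VII Lemma 1 b): "`F` extends to a unitary operator on `L²(X_S)`".  PROVED.  RH-FREE.
[cite: Connes1999, §VII Lemma 1 b) (arXiv p0012); ConnesConsaniMoscovici2024, Prop. 4.2 (ii) §4.2 p. 18] -/
theorem semilocalFourierOf_mem_unitary (P : Finset ℕ) :
    semilocalFourierOf P ∈ unitary (Lp ℂ 2 (volume : Measure ℝ) →L[ℂ] Lp ℂ 2 (volume : Measure ℝ)) :=
  (isUnit_semilocalFourierOf P).mem_unitary_of_star_mul_self <|
    (semilocalFourierOf P).norm_map_iff_adjoint_comp_self.mp (norm_semilocalFourierOf P)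

/-- **`𝔽_S^* = 𝔽_S⁻¹`**: the adjoint of `𝔽_S` is its inverse `θ_S 𝓕⁻¹ θ_S⁻¹`. [cite: Connes1999, §VII Lemma 1 b) (arXiv p0012)] -/
theorem adjoint_semilocalFourierOf (P : Finset ℕ) :
    ContinuousLinearMap.adjoint (semilocalFourierOf P) = semilocalFourierInvOf P := by
  have h1 : ContinuousLinearMap.adjoint (semilocalFourierOf P) * semilocalFourierOf P = 1 :=
    Unitary.star_mul_self_of_mem (semilocalFourierOf_mem_unitary P)
  calc ContinuousLinearMap.adjoint (semilocalFourierOf P)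
      = ContinuousLinearMap.adjoint (semilocalFourierOf P) * (semilocalFourierOf P * semilocalFourierInvOf P) := by
        rw [semilocalFourierOf_mul_inv, mul_one]
    _ = semilocalFourierInvOf P := by rw [← mul_assoc, h1, one_mul]

/-- For `S = {∞, p}`: the row file's `semilocalFourier p` is unitary. [cite: ConnesConsaniMoscovici2024, Prop. 4.2 (ii) §4.2 p. 18; Def. 4.5 §4.6 p. 21] -/
theorem semilocalFourier_mem_unitary (q : ℕ) [Fact q.Prime] :
    semilocalFourier q ∈ unitary (Lp ℂ 2 (volume : Measure ℝ) →L[ℂ] Lp ℂ 2 (volume : Measure ℝ)) := by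
  rw [← semilocalFourierOf_singleton]
  exact semilocalFourierOf_mem_unitary {q}

/-- **The ultraviolet cutoff `P̂_Λ = 𝔽_S P_Λ 𝔽_S⁻¹` is idempotent.** [cite: Connes1999, §VII eq. (13) (arXiv p0013)] -/
theorem dualCutoffProj_mul_self (P : Finset ℕ) (Λ : ℝ) :
    dualCutoffProj P Λ * dualCutoffProj P Λ = dualCutoffProj P Λ := by
  unfold dualCutoffProj
  calc semilocalFourierOf P * cutoffProj Λ * semilocalFourierInvOf P *
        (semilocalFourierOf P * cutoffProj Λ * semilocalFourierInvOf P)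
      = semilocalFourierOf P * cutoffProj Λ * (semilocalFourierInvOf P * semilocalFourierOf P) *
          cutoffProj Λ * semilocalFourierInvOf P := by simp only [mul_assoc]
    _ = semilocalFourierOf P * cutoffProj Λ * semilocalFourierInvOf P := by
        rw [semilocalFourierInvOf_mul, mul_one, mul_assoc (semilocalFourierOf P) (cutoffProj Λ),
          cutoffProj_mul_self]

/-- `P_Λ` is self-adjoint. [cite: Connes1999, §VII eq. (12) (arXiv p0013)] -/
theorem adjoint_cutoffProj (Λ : ℝ) : ContinuousLinearMap.adjoint (cutoffProj Λ) = cutoffProj Λ := by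
  symm
  rw [ContinuousLinearMap.eq_adjoint_iff]
  exact fun x y => inner_cutoffProj_left Λ x y

/-- **The ultraviolet cutoff `P̂_Λ = 𝔽_S P_Λ 𝔽_S⁻¹` is self-adjoint** (`𝔽_S⁻¹ = 𝔽_S^*`), hence an ORTHOGONAL
projection of `L²(ℝ)`, as in Connes 1999 §VII (13). PROVED. RH-FREE. [cite: Connes1999, §VII eq. (13) (arXiv p0013)] -/
theorem adjoint_dualCutoffProj (P : Finset ℕ) (Λ : ℝ) :
    ContinuousLinearMap.adjoint (dualCutoffProj P Λ) = dualCutoffProj P Λ := by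
  have hstar : ContinuousLinearMap.adjoint (semilocalFourierInvOf P) = semilocalFourierOf P := by
    rw [← adjoint_semilocalFourierOf, ContinuousLinearMap.adjoint_adjoint]
  unfold dualCutoffProj
  rw [← ContinuousLinearMap.star_eq_adjoint, star_mul, star_mul, ContinuousLinearMap.star_eq_adjoint,
    ContinuousLinearMap.star_eq_adjoint, ContinuousLinearMap.star_eq_adjoint, hstar, adjoint_cutoffProj,
    adjoint_semilocalFourierOf, mul_assoc]

/-- `P̂_Λ` is a star projection (self-adjoint idempotent). [cite: Connes1999, §VII eq. (13) (arXiv p0013)] -/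
theorem isStarProjection_dualCutoffProj (P : Finset ℕ) (Λ : ℝ) : IsStarProjection (dualCutoffProj P Λ) :=
  ⟨dualCutoffProj_mul_self P Λ, by
    rw [IsSelfAdjoint, ContinuousLinearMap.star_eq_adjoint, adjoint_dualCutoffProj]⟩

end Unitary

/-! ## Eq. (44)–(45) pointwise: `(η_S ξ)(x) = Σ_{γ ∈ Γ_+ ∩ ℤ} ξ(γx)` for almost every `x` -/

section Pointwise

/-- `D_n ξ = ξ(n ·)` a.e. for a positive integer `n`. [cite: ConnesConsaniMoscovici2024, §4.2 eq. (44) p. 16 (arXiv chunk p0012:L74)] -/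
theorem natDilation_coeFn {n : ℕ} (hn : n ≠ 0) (ξ : Lp ℂ 2 (volume : Measure ℝ)) :
    ((natDilation n ξ : Lp ℂ 2 (volume : Measure ℝ)) : ℝ → ℂ) =ᵐ[volume] fun x => (ξ : ℝ → ℂ) ((n : ℝ) * x) := by
  rw [natDilation_of_ne_zero hn]
  have h := lpDilation_coeFn (V := ℝ) (F := ℂ) (p := (2 : ℝ≥0∞)) (Nat.cast_ne_zero.mpr hn)
    ENNReal.ofNat_ne_top ξ
  simpa only [smul_eq_mul] using h

/-- `Σ_{n P-factored} ‖D_n ξ‖ < ∞` in the extended reals (`‖D_n ξ‖ ≤ n^{−1/2}‖ξ‖`). [cite: ConnesConsaniMoscovici2024, §4.2 eq. (44) p. 16] -/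
theorem tsum_enorm_natDilation_apply_ne_top {P : Finset ℕ} (hP : ∀ p ∈ P, p.Prime)
    (ξ : Lp ℂ 2 (volume : Measure ℝ)) :
    ∑' n : Nat.factoredNumbers P, ‖natDilation n ξ‖ₑ ≠ ∞ := by
  have hs : Summable fun n : Nat.factoredNumbers P => ‖natDilation n‖ * ‖ξ‖ :=
    (summable_norm_natDilation hP).mul_right _
  have hle : ∀ n : Nat.factoredNumbers P, ‖natDilation n ξ‖ ≤ ‖natDilation n‖ * ‖ξ‖ := fun n =>
    ContinuousLinearMap.le_opNorm _ _
  have h2 : Summable fun n : Nat.factoredNumbers P => ‖natDilation n ξ‖ :=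
    Summable.of_nonneg_of_le (fun _ => norm_nonneg _) hle hs
  exact tsum_enorm_ne_top_iff_summable_norm.2 h2

/-- **Eq. (44)–(45) pointwise, general finite `S ∋ ∞`**: `(η_S ξ)(x) = Σ_{γ ∈ Γ_+ ∩ ℤ} ξ(γx)` for almost every
`x`, the series converging (absolutely) almost everywhere — "`η_S(f)(1 × u) = Σ_{Γ_+ ∩ ℤ} f(γu)`", i.e.
`w_S(η_S(f)) = ℰ_S(f)` at the level of functions.  PROVED (absolutely summable series in `L²` converge a.e.,
Mathlib `Lp.hasSum_coeFn_tsum`).  RH-FREE. [cite: ConnesConsaniMoscovici2024, §4.2 eq. (44) and the display after it, eq. (45) pp. 16–17 (arXiv chunk p0012:L74–L87)] -/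
theorem hasSum_coeFn_etaProd {P : Finset ℕ} (hP : ∀ p ∈ P, p.Prime) (ξ : Lp ℂ 2 (volume : Measure ℝ)) :
    ∀ᵐ x : ℝ, HasSum (fun n : Nat.factoredNumbers P => (ξ : ℝ → ℂ) (((n : ℕ) : ℝ) * x))
      (((etaProd P ξ : Lp ℂ 2 (volume : Measure ℝ)) : ℝ → ℂ) x) := by
  have h1 := Lp.hasSum_coeFn_tsum (tsum_enorm_natDilation_apply_ne_top hP ξ)
  have h2 : (∑' n : Nat.factoredNumbers P, natDilation n ξ) = etaProd P ξ :=
    (hasSum_natDilation_apply_etaProd hP ξ).tsum_eq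
  have h3 : ∀ᵐ x : ℝ, ∀ n : Nat.factoredNumbers P,
      ((natDilation n ξ : Lp ℂ 2 (volume : Measure ℝ)) : ℝ → ℂ) x = (ξ : ℝ → ℂ) (((n : ℕ) : ℝ) * x) :=
    ae_all_iff.2 fun n => natDilation_coeFn (Nat.ne_zero_of_mem_factoredNumbers n.2) ξ
  filter_upwards [h1, h3] with x hx hx'
  rw [h2] at hx
  simpa only [hx'] using hx

/-- **`w_S(η_S f) = ℰ_S(f)`** (eq. (45)) pulled back: `η_S ξ = factoredSum P ξ` almost everywhere.
[cite: ConnesConsaniMoscovici2024, §4.2 eq. (45)–(46) p. 17 (arXiv chunk p0012:L85–L94)] -/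
theorem etaProd_coeFn_eq_factoredSum {P : Finset ℕ} (hP : ∀ p ∈ P, p.Prime) (ξ : Lp ℂ 2 (volume : Measure ℝ)) :
    ((etaProd P ξ : Lp ℂ 2 (volume : Measure ℝ)) : ℝ → ℂ) =ᵐ[volume] factoredSum P (ξ : ℝ → ℂ) := by
  filter_upwards [hasSum_coeFn_etaProd hP ξ] with x hx
  exact hx.tsum_eq.symm

/-- The series `Σ_{n P-factored} ξ(nx)` converges absolutely for a.e. `x` (`ξ ∈ L²(ℝ)`). [cite: ConnesConsaniMoscovici2024, §4.2 eq. (44) p. 16 (arXiv chunk p0012:L74–L81)] -/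
theorem ae_summable_norm_comp_mul {P : Finset ℕ} (hP : ∀ p ∈ P, p.Prime) (ξ : Lp ℂ 2 (volume : Measure ℝ)) :
    ∀ᵐ x : ℝ, Summable fun n : Nat.factoredNumbers P => ‖(ξ : ℝ → ℂ) (((n : ℕ) : ℝ) * x)‖ := by
  have h1 := summable_norm_of_tsum_eLpNorm_ne_top (p := (2 : ℝ≥0∞)) (μ := (volume : Measure ℝ))
    (by norm_num) (fun n : Nat.factoredNumbers P =>
      Lp.aestronglyMeasurable (natDilation n ξ : Lp ℂ 2 (volume : Measure ℝ))) ?_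
  · have h3 : ∀ᵐ x : ℝ, ∀ n : Nat.factoredNumbers P,
        ((natDilation n ξ : Lp ℂ 2 (volume : Measure ℝ)) : ℝ → ℂ) x = (ξ : ℝ → ℂ) (((n : ℕ) : ℝ) * x) :=
      ae_all_iff.2 fun n => natDilation_coeFn (Nat.ne_zero_of_mem_factoredNumbers n.2) ξ
    filter_upwards [h1, h3] with x hx hx'
    simpa only [hx'] using hx
  · have h := tsum_enorm_natDilation_apply_ne_top hP ξ
    simpa only [Lp.enorm_def] using h

end Pointwise

end Literature.NumberTheory.ConnesConsani2024
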